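import Literature.Geometry.Symplectic.JPlanePencilLocalFamily
import Literature.Geometry.Symplectic.GromovR4RelEnd
import Mathlib.Analysis.InnerProductSpace.Calculus

/-!
# `jPlanePencil_localFamily` is false: the pencil of lines on `Bl₀(ℂ²) ∪ {∞} ≅ ℂP²-bar`

This file PROVES `¬ Literature.Geometry.Symplectic.jPlanePencil_localFamily`
(`Literature.Geometry.Symplectic.not_jPlanePencil_localFamily`), making the erratum in
`JPlanePencilLocalFamily.lean` a theorem: the named fact (Gromov 1985 / Hofer–Lizan–Sikorav 1997 /
Wendl, LNM 2216, Prop. 2.53 with `m = 1`, filed for EVERY compact `4`-manifold `M`) omits Wendl's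
hypothesis `[û]·[û] = m` on the self-intersection of the member, and fails on the simplest compact
`4`-manifold with `H₂ ≠ 0` carrying a flat end. (The corrected, homotopy-`4`-sphere statement is
`jPlanePencil_localFamily_homotopySphere` in that file.)

## The counterexample (Wendl, LNM 2216, §3.1: the complex blow-up)

* `JPlanePencilCounterexample.BlowupPt` — the compact smooth `4`-manifold
  `M = Bl₀(ℂ²) ∪ {∞}`, the one-point compactification (at the flat end) of the blow-up
  `Bl₀(ℂ²) = {(y, ℓ) ∈ ℂ² × ℂP¹ | y ∈ ℓ}` of `ℂ²` at the origin (`M ≅ S⁴ # ℂP²-bar ≅ ℂP²-bar`,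
  Wendl Exercise 3.3). Its points are listed without repetition as `zs (z, s)` (the point
  `((z, z s), [1 : s])`), `ax w` (the point `((0, w), [0 : 1])`) and `inf`; it is charted on `ℝ⁴` by
  the THREE charts `(z, s)` (`zsEquiv`), `(t, w)` (`twEquiv`, the point `((t w, w), [t : 1])`) and
  the chart at infinity `ι ∘ π` (`infEquiv`; `π = BlowupPt.proj` the blow-down map, `ι` the inversion
  of `ℝ⁴`), whose nine transition maps are rational, hence smooth; the topology is the one generated by
  the charts (`ChartedSpaceCore`), and `M` is a `T₂`, second countable, compact `C^∞` manifold
  (`instIsManifold`, `instT2Space`, `instSecondCountable`, `instCompactSpace`).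
* `p = ∞`, `ε' = 1/2`: the chart at infinity is the TOTAL function `ι ∘ π` (`π ∞ = 0`), so the flat
  coordinates of the fact are the blow-down map on the nose: `pencilCoord ∞ x = π x`
  (`BlowupPt.pencilCoord_eq`).
* `J = JPlanePencilCounterexample.BlowupPt.blowupJ` — the (integrable) complex structure of the
  blow-up: since every preferred chart away from `∞` is holomorphic, it is the CONSTANT `mulI4`
  (multiplication by `i` on `ℝ⁴ = ℂ²`) in the tangent trivialisations; `J² = -1` (`blowupJ_sq`), `J`
  is smooth (`blowupJ_smooth`: one tangent coordinate change is complex linear, the rest is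
  `coordChange_comp`) and STANDARD on the whole chart at infinity (`blowupJ_standard`:
  `De = Dι(π x) ∘ A` with `A` complex linear, `Dι(ι y) ∘ Dι(y) = id`, and `⟪i a, c⟫ = ω₀(a, c)`).
* `u₀ = JPlanePencilCounterexample.BlowupPt.u₀`, `ξ ↦ zs (ξ, 0)` — the proper transform of the
  `z`-axis `{w = 0}`, a pencil member of intercept `0` (`isPencilPlane_u₀`) through the point
  `[1 : 0]` of the exceptional sphere `E = π⁻¹(0)` (class `H − E`, self-intersection `0 ≠ 1 = m`).

## The refutation

For a member `u` of intercept `b` (for this `J`), `π ∘ u : ℂ → ℂ²` is entire — the blow-down of a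
`J`-curve is holomorphic (`differentiable_proj_comp`: the real derivative of `π ∘ u` is
`cx ∘ A ∘ du`, complex linear) — with `z(ξ) − ξ → 0` and `w(ξ) → b` at infinity, so by Liouville
`π (u ξ) = (ξ, b)` identically (`proj_member`): the member of intercept `b ≠ 0` is the lifted line and
passes through `π⁻¹(0, b) = ax b` at `ξ = 0` (`member_zero`). If `Floc` were a family through
`Floc 0 = u₀` as in the conclusion, `b ↦ Floc b 0` would be continuous at `0` (`ContMDiffOn` on the
open set `ball 0 δ × ℂ`), i.e. `ax b → u₀ 0 = zs (0, 0) = [1 : 0]`; but `ax b → ax 0 = [0 : 1]`, a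
different point of `E` — contradiction (`not_jPlanePencil_localFamily`). Geometrically: in
`ℂP² # ℂP²-bar` the lines through the point `q_a` at infinity degenerate, at intercept `0`, to the
nodal curve `(H − E) ∪ E`.

## Design

Everything is elementary (no Fredholm theory, no intersection theory): about 1000 lines build the
manifold by hand (Mathlib has no projective spaces or blow-ups as manifolds, and no gluing of charts),
the rest checks the hypotheses of the fact and runs Liouville
(`Literature.Geometry.Symplectic.exists_restrictScalars_eq_of_map_mul_I`,
Mathlib's `Differentiable.apply_eq_apply_of_bounded`). The linear identification `ℝ⁴ = ℂ²` is
`(y₀ + i y₁, y₂ + i y₃)` (`cx`/`rl`), the convention of `pencilCoord`. Deliberately NOT here: the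
identification of `M` with `ℂP²-bar` or `S⁴ # ℂP²-bar`, its intersection form, orientations, and
the (true) corrected statement for homotopy spheres.

## References

* C. Wendl, *Holomorphic Curves in Low Dimensions*, Lecture Notes in Math. 2216, Springer 2018,
  §3.1 (the complex blow-up, the exceptional sphere), Exercise 3.3, Prop. 2.53 (hypothesis
  `[u]·[u] = m`), Thm 2.46, Thm 2.49 [Wendl2018].
-/

noncomputable section

open scoped Manifold ContDiff Topology ComplexConjugate
open Set Filter Function

namespace Literature.Geometry.Symplectic

namespace JPlanePencilCounterexample

local notation "E4" => EuclideanSpace ℝ (Fin 4)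

/-! ### `ℝ⁴ = ℂ²`: the complex coordinates `(y₀ + i y₁, y₂ + i y₃)` of `pencilCoord` -/

/-- The complex coordinates `(y₀ + i y₁, y₂ + i y₃)` of a vector of `ℝ⁴` (the convention of
`pencilCoord`). [folklore] -/
def cx (v : E4) : ℂ × ℂ := (⟨v 0, v 1⟩, ⟨v 2, v 3⟩)

/-- The real coordinates of a point of `ℂ²` (inverse of `cx`). [folklore] -/
def rl (q : ℂ × ℂ) : E4 := !₂[q.1.re, q.1.im, q.2.re, q.2.im]

/-- Coordinate `0` of `rl q` is `Re q.1`. [folklore] -/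
@[simp] theorem rl_apply_zero (q : ℂ × ℂ) : rl q 0 = q.1.re := rfl
/-- Coordinate `1` of `rl q` is `Im q.1`. [folklore] -/
@[simp] theorem rl_apply_one (q : ℂ × ℂ) : rl q 1 = q.1.im := rfl
/-- Coordinate `2` of `rl q` is `Re q.2`. [folklore] -/
@[simp] theorem rl_apply_two (q : ℂ × ℂ) : rl q 2 = q.2.re := rfl
/-- Coordinate `3` of `rl q` is `Im q.2`. [folklore] -/
@[simp] theorem rl_apply_three (q : ℂ × ℂ) : rl q 3 = q.2.im := rfl
/-- `Re (cx v).1 = v 0`. [folklore] -/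
@[simp] theorem cx_fst_re (v : E4) : (cx v).1.re = v 0 := rfl
/-- `Im (cx v).1 = v 1`. [folklore] -/
@[simp] theorem cx_fst_im (v : E4) : (cx v).1.im = v 1 := rfl
/-- `Re (cx v).2 = v 2`. [folklore] -/
@[simp] theorem cx_snd_re (v : E4) : (cx v).2.re = v 2 := rfl
/-- `Im (cx v).2 = v 3`. [folklore] -/
@[simp] theorem cx_snd_im (v : E4) : (cx v).2.im = v 3 := rfl

/-- `cx ∘ rl = id`. [folklore] -/
@[simp] theorem cx_rl (q : ℂ × ℂ) : cx (rl q) = q := by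
  ext <;> rfl

/-- `rl ∘ cx = id`. [folklore] -/
@[simp] theorem rl_cx (v : E4) : rl (cx v) = v := by
  ext i
  fin_cases i <;> rfl

/-- `cx` as a continuous real-linear equivalence `ℝ⁴ ≃L[ℝ] ℂ²`. [folklore] -/
def cxEquiv : E4 ≃L[ℝ] ℂ × ℂ :=
  LinearEquiv.toContinuousLinearEquiv
    { toFun := cx
      invFun := rl
      map_add' := fun a b => by apply Prod.ext <;> apply Complex.ext <;> simp [cx]
      map_smul' := fun c a => by apply Prod.ext <;> apply Complex.ext <;> simp [cx]
      left_inv := rl_cx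
      right_inv := cx_rl }

/-- `cxEquiv` is `cx`. [folklore] -/
@[simp] theorem cxEquiv_apply (v : E4) : cxEquiv v = cx v := rfl
/-- `cxEquiv.symm` is `rl`. [folklore] -/
@[simp] theorem cxEquiv_symm_apply (q : ℂ × ℂ) : cxEquiv.symm q = rl q := rfl

/-- `cx` is continuous. [folklore] -/
theorem continuous_cx : Continuous cx := cxEquiv.continuous
/-- `rl` is continuous. [folklore] -/
theorem continuous_rl : Continuous rl := cxEquiv.symm.continuous

/-- `rl` is injective. [folklore] -/
theorem rl_injective : Injective rl := cxEquiv.symm.injective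

/-- `cx` maps the origin to the origin `(0, 0)`. [folklore] -/
@[simp] theorem cx_origin : cx 0 = ((0 : ℂ), (0 : ℂ)) := map_zero cxEquiv
/-- `rl 0 = 0`. [folklore] -/
@[simp] theorem rl_zero : rl 0 = 0 := map_zero cxEquiv.symm
/-- `cx` is real-homogeneous. [folklore] -/
theorem cx_smul (c : ℝ) (v : E4) : cx (c • v) = c • cx v := map_smul cxEquiv c v
/-- `rl` is real-homogeneous. [folklore] -/
theorem rl_smul (c : ℝ) (q : ℂ × ℂ) : rl (c • q) = c • rl q := map_smul cxEquiv.symm c q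
/-- `rl q = 0 ↔ q = 0`. [folklore] -/
@[simp] theorem rl_eq_zero {q : ℂ × ℂ} : rl q = 0 ↔ q = 0 := cxEquiv.symm.map_eq_zero_iff
/-- `cx v = 0 ↔ v = 0`. [folklore] -/
@[simp] theorem cx_eq_zero {v : E4} : cx v = 0 ↔ v = 0 := cxEquiv.map_eq_zero_iff

/-- `‖rl (z, w)‖² = |z|² + |w|²` (the Euclidean norm of `ℝ⁴`, NOT the sup norm of `ℂ × ℂ`).
[folklore] -/
theorem norm_rl_sq (q : ℂ × ℂ) : ‖rl q‖ ^ 2 = Complex.normSq q.1 + Complex.normSq q.2 := by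
  rw [EuclideanSpace.real_norm_sq_eq, Fin.sum_univ_four, rl_apply_zero, rl_apply_one, rl_apply_two,
    rl_apply_three, Complex.normSq_apply, Complex.normSq_apply]
  ring

/-- `‖v‖² = |z|² + |w|²` for `(z, w) = cx v`. [folklore] -/
theorem norm_sq_eq_normSq (v : E4) : ‖v‖ ^ 2 = Complex.normSq (cx v).1 + Complex.normSq (cx v).2 := by
  rw [← norm_rl_sq, rl_cx]

/-! ### The constant complex structure `i` of `ℂ²` on `ℝ⁴` -/

/-- Multiplication by `i` on `ℝ⁴ = ℂ²`: `(y₀, y₁, y₂, y₃) ↦ (-y₁, y₀, -y₃, y₂)`. [folklore] -/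
def mulI4 : E4 →L[ℝ] E4 :=
  (cxEquiv.symm : ℂ × ℂ →L[ℝ] E4).comp ((mulByI (ℂ × ℂ)).comp (cxEquiv : E4 →L[ℝ] ℂ × ℂ))

/-- `mulI4 v = rl (i • cx v)`. [folklore] -/
theorem mulI4_apply (v : E4) : mulI4 v = rl (Complex.I • cx v) := rfl

/-- In complex coordinates `mulI4` is multiplication by `i`. [folklore] -/
theorem cx_mulI4 (v : E4) : cx (mulI4 v) = Complex.I • cx v := by
  rw [mulI4_apply, cx_rl]

/-- Coordinate `0` of `i v` is `-v 1`. [folklore] -/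
@[simp] theorem mulI4_apply_zero (v : E4) : mulI4 v 0 = -v 1 := by simp [mulI4_apply, cx]
/-- Coordinate `1` of `i v` is `v 0`. [folklore] -/
@[simp] theorem mulI4_apply_one (v : E4) : mulI4 v 1 = v 0 := by simp [mulI4_apply, cx]
/-- Coordinate `2` of `i v` is `-v 3`. [folklore] -/
@[simp] theorem mulI4_apply_two (v : E4) : mulI4 v 2 = -v 3 := by simp [mulI4_apply, cx]
/-- Coordinate `3` of `i v` is `v 2`. [folklore] -/
@[simp] theorem mulI4_apply_three (v : E4) : mulI4 v 3 = v 2 := by simp [mulI4_apply, cx]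

/-- `mulI4² = -1`. [folklore] -/
theorem mulI4_mulI4 (v : E4) : mulI4 (mulI4 v) = -v := by
  ext i
  fin_cases i <;> simp

/-- `⟪i a, c⟫ = ω₀(a, c)` on `ℝ⁴`: the standard complex structure is `ω₀`-compatible with the
Euclidean metric, in the conventions of `pencilCoord` / `stdSymplecticForm`. [folklore] -/
theorem inner_mulI4_eq_stdSymplecticForm (a c : E4) : inner ℝ (mulI4 a) c = stdSymplecticForm a c := by
  rw [PiLp.inner_apply, Fin.sum_univ_four]
  simp only [stdSymplecticForm, RCLike.inner_apply, conj_trivial, mulI4_apply_zero, mulI4_apply_one,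
    mulI4_apply_two, mulI4_apply_three]
  ring

/-- A real-linear map of `ℂ²` which is complex linear commutes with `i`, transported to `ℝ⁴`.
[folklore] -/
theorem mulI4_comm_of_restrictScalars (L : ℂ × ℂ →L[ℂ] ℂ × ℂ) (v : E4) :
    rl (L.restrictScalars ℝ (cx (mulI4 v))) = mulI4 (rl (L.restrictScalars ℝ (cx v))) := by
  rw [mulI4_apply, mulI4_apply, cx_rl, cx_rl, ContinuousLinearMap.coe_restrictScalars', L.map_smul]


/-! ### The carrier: `Bl₀(ℂ²) ∪ {∞}` as a set -/

/-- The points of `M = Bl₀(ℂ²) ∪ {∞}`, the one-point compactification of the complex blow-up of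
`ℂ²` at the origin (Wendl, LNM 2216, §3.1), listed WITHOUT repetition through two of its holomorphic
charts: `zs (z, s)` is the point `((z, z s), [1 : s])` of `Bl₀(ℂ²) = {(y, ℓ) ∈ ℂ² × ℂP¹ | y ∈ ℓ}`
(all points off the proper transform of the `w`-axis `{z = 0}`), `ax w` is the point
`((0, w), [0 : 1])` of that proper transform (`ax 0 = [0 : 1] ∈ E`, the one point of the
exceptional sphere `E = {y = 0}` not of the form `zs (0, s) = [1 : s]`), and `inf` is the point at
infinity. [cite: Wendl2018, §3.1] -/
inductive BlowupPt : Type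
  | zs : ℂ × ℂ → BlowupPt
  | ax : ℂ → BlowupPt
  | inf : BlowupPt

namespace BlowupPt

/-- The blow-down map `π : Bl₀(ℂ²) → ℂ²`, extended by the junk value `π ∞ = 0`. [cite: Wendl2018, §3.1] -/
def proj : BlowupPt → ℂ × ℂ
  | zs v => (v.1, v.1 * v.2)
  | ax w => (0, w)
  | inf => 0

/-- The section of `π` over `ℂ²`: the unique point of `Bl₀(ℂ²) ∖ E` over `y ≠ 0` (and `[0 : 1]`
over `0`). [folklore] -/
def sect (y : ℂ × ℂ) : BlowupPt :=
  if y.1 = 0 then ax y.2 else zs (y.1, y.2 / y.1)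

/-- `π (zs (z, s)) = (z, z s)`. [folklore] -/
@[simp] theorem proj_zs (v : ℂ × ℂ) : proj (zs v) = (v.1, v.1 * v.2) := rfl
/-- `π (ax w) = (0, w)`. [folklore] -/
@[simp] theorem proj_ax (w : ℂ) : proj (ax w) = (0, w) := rfl
/-- Junk value `π ∞ = 0`. [folklore] -/
@[simp] theorem proj_inf : proj inf = 0 := rfl

/-- `π ∘ sect = id` on all of `ℂ²`. [folklore] -/
@[simp] theorem proj_sect (y : ℂ × ℂ) : proj (sect y) = y := by
  unfold sect
  split_ifs with h
  · ext <;> simp [h]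
  · ext <;> simp [mul_div_cancel₀ _ h]

/-- `sect ∘ π = id` off the exceptional sphere, chart `(z, s)`. [folklore] -/
theorem sect_proj_zs {v : ℂ × ℂ} (hv : v.1 ≠ 0) : sect (proj (zs v)) = zs v := by
  simp [sect, hv, mul_div_cancel_left₀ _ hv]

/-- `sect ∘ π = id` on the proper transform of the `w`-axis. [folklore] -/
@[simp] theorem sect_proj_ax (w : ℂ) : sect (proj (ax w)) = ax w := by
  simp [sect]

/-- `sect` never takes the value `∞`. [folklore] -/
theorem sect_ne_inf (y : ℂ × ℂ) : sect y ≠ inf := by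
  unfold sect; split_ifs <;> simp

/-- `sect` over the `w`-axis. [folklore] -/
theorem sect_of_fst_eq_zero {y : ℂ × ℂ} (h : y.1 = 0) : sect y = ax y.2 := by simp [sect, h]

/-- `sect` off the `w`-axis. [folklore] -/
theorem sect_of_fst_ne_zero {y : ℂ × ℂ} (h : y.1 ≠ 0) : sect y = zs (y.1, y.2 / y.1) := by
  simp [sect, h]

/-- `π x = 0` exactly on `E ∪ {∞}`. [folklore] -/
theorem proj_zs_ne_zero_iff (v : ℂ × ℂ) : proj (zs v) ≠ 0 ↔ v.1 ≠ 0 := by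
  constructor
  · intro h h1
    apply h
    ext <;> simp [h1]
  · intro h h0
    exact h (congrArg Prod.fst h0)

/-! ### The three charts, as partial equivalences with values in `ℝ⁴` -/

/-- Chart `(z, s)` (the blow-up chart `{l₀ ≠ 0}`), with values in `ℝ⁴`. [folklore] -/
def zsFun : BlowupPt → E4
  | zs v => rl v
  | ax _ => 0
  | inf => 0

/-- Chart `(t, w)` (the blow-up chart `{l₁ ≠ 0}`: the point `((t w, w), [t : 1])`), values in `ℝ⁴`;
on `zs (z, s)` with `s ≠ 0` it reads `(s⁻¹, z s)`. [folklore] -/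
def twFun : BlowupPt → E4
  | zs v => rl (v.2⁻¹, v.1 * v.2)
  | ax w => rl (0, w)
  | inf => 0

/-- Inverse of the chart `(t, w)`. [folklore] -/
def twInv (u : E4) : BlowupPt :=
  if (cx u).1 = 0 then ax (cx u).2 else zs ((cx u).1 * (cx u).2, (cx u).1⁻¹)

/-- The chart at infinity `ι ∘ π` (a TOTAL function: `ι (π x)` in real coordinates, `∞ ↦ 0`).
[folklore] -/
def infFun (x : BlowupPt) : E4 := inversion (rl (proj x))

/-- Inverse of the chart at infinity. [folklore] -/
def infInv (u : E4) : BlowupPt := if u = 0 then inf else sect (cx (inversion u))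

/-- The source of the chart `(t, w)`: all points but `zs (z, 0)` (the proper transform of the
`z`-axis) and `∞`. [folklore] -/
def twSource : Set BlowupPt := {x | match x with | zs v => v.2 ≠ 0 | ax _ => True | inf => False}

/-- The source of the chart at infinity: `{‖π x‖ > 1} ∪ {∞}`. [folklore] -/
def infSource : Set BlowupPt := {x | x = inf ∨ 1 < ‖rl (proj x)‖}

/-- `zs (z, s)` is in the source of `(t, w)` iff `s ≠ 0`. [folklore] -/
@[simp] theorem zs_mem_twSource (v : ℂ × ℂ) : zs v ∈ twSource ↔ v.2 ≠ 0 := Iff.rfl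
/-- `ax w` is in the source of `(t, w)`. [folklore] -/
@[simp] theorem ax_mem_twSource (w : ℂ) : ax w ∈ twSource := trivial
/-- `∞` is not in the source of `(t, w)`. [folklore] -/
@[simp] theorem inf_not_mem_twSource : inf ∉ twSource := fun h => h
/-- `∞` is in the source of the chart at infinity. [folklore] -/
@[simp] theorem inf_mem_infSource : inf ∈ infSource := Or.inl rfl
/-- A point `x ≠ ∞` is in the source of the chart at infinity iff `‖π x‖ > 1`. [folklore] -/
theorem mem_infSource_of_ne {x : BlowupPt} (hx : x ≠ inf) : x ∈ infSource ↔ 1 < ‖rl (proj x)‖ := by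
  simp [infSource, hx]
/-- Membership of `zs v` in the source of the chart at infinity. [folklore] -/
@[simp] theorem zs_mem_infSource (v : ℂ × ℂ) : zs v ∈ infSource ↔ 1 < ‖rl (v.1, v.1 * v.2)‖ := by
  simp [infSource]
/-- Membership of `ax w` in the source of the chart at infinity. [folklore] -/
@[simp] theorem ax_mem_infSource (w : ℂ) : ax w ∈ infSource ↔ 1 < ‖rl (0, w)‖ := by
  simp [infSource]

/-- The chart `(z, s)`: source `{zs v}`, target all of `ℝ⁴`. [folklore] -/
def zsEquiv : PartialEquiv BlowupPt E4 where
  toFun := zsFun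
  invFun u := zs (cx u)
  source := Set.range zs
  target := univ
  map_source' _ _ := trivial
  map_target' u _ := ⟨cx u, rfl⟩
  left_inv' := by
    rintro _ ⟨v, rfl⟩
    simp [zsFun]
  right_inv' u _ := by simp [zsFun]

/-- The chart `(t, w)`: source `twSource`, target all of `ℝ⁴`. [folklore] -/
def twEquiv : PartialEquiv BlowupPt E4 where
  toFun := twFun
  invFun := twInv
  source := twSource
  target := univ
  map_source' _ _ := trivial
  map_target' u _ := by
    unfold twInv
    split_ifs with h
    · trivial
    · exact inv_ne_zero h
  left_inv' := by
    rintro (v | w | _) hx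
    · have hs : v.2 ≠ 0 := hx
      simp only [twFun, twInv, cx_rl, inv_eq_zero, hs, if_false, inv_inv]
      congr 1
      ext
      · change v.2⁻¹ * (v.1 * v.2) = v.1
        field_simp
      · rfl
    · simp [twFun, twInv]
    · exact absurd hx inf_not_mem_twSource
  right_inv' u _ := by
    unfold twInv
    split_ifs with h
    · simp only [twFun]
      rw [← rl_cx u]
      congr 1
      ext <;> simp [h]
    · simp only [twFun, inv_inv]
      rw [← rl_cx u]
      congr 1
      simp only [cx_rl]
      ext
      · rfl
      · change (cx u).1 * (cx u).2 * ((cx u).1)⁻¹ = (cx u).2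
        field_simp

/-- On the source of the chart at infinity (minus `∞`), `π ≠ 0`. [folklore] -/
theorem norm_rl_proj_pos_of_mem_infSource {x : BlowupPt} (hx : x ∈ infSource) (hne : x ≠ inf) :
    0 < ‖rl (proj x)‖ :=
  lt_trans zero_lt_one ((mem_infSource_of_ne hne).1 hx)

/-- The chart at infinity: source `infSource`, target the open unit ball. [folklore] -/
def infEquiv : PartialEquiv BlowupPt E4 where
  toFun := infFun
  invFun := infInv
  source := infSource
  target := Metric.ball 0 1
  map_source' x hx := by
    rcases eq_or_ne x inf with rfl | hne
    · simp [infFun]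
    · have h1 := (mem_infSource_of_ne hne).1 hx
      rw [Metric.mem_ball, dist_zero_right, infFun, norm_inversion]
      exact inv_lt_one_of_one_lt₀ h1
  map_target' u hu := by
    unfold infInv
    split_ifs with h
    · exact inf_mem_infSource
    · rw [Metric.mem_ball, dist_zero_right] at hu
      refine (mem_infSource_of_ne (sect_ne_inf _)).2 ?_
      rw [proj_sect, rl_cx, norm_inversion]
      exact one_lt_inv_iff₀.2 ⟨norm_pos_iff.2 h, hu⟩
  left_inv' x hx := by
    rcases eq_or_ne x inf with rfl | hne
    · simp [infFun, infInv]
    · have hpos := norm_rl_proj_pos_of_mem_infSource hx hne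
      have hne0 : rl (proj x) ≠ 0 := norm_pos_iff.1 hpos
      have h0 : inversion (rl (proj x)) ≠ 0 := inversion_ne_zero hne0
      change (if inversion (rl (proj x)) = 0 then inf
        else sect (cx (inversion (inversion (rl (proj x)))))) = x
      rw [if_neg h0, inversion_inversion, cx_rl]
      rcases x with v | w | _
      · refine sect_proj_zs ?_
        exact (proj_zs_ne_zero_iff v).1 fun h0 => hne0 (by rw [h0, rl_zero])
      · exact sect_proj_ax w
      · exact absurd rfl hne
  right_inv' u hu := by
    unfold infInv
    split_ifs with h
    · subst h; simp [infFun]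
    · simp [infFun, inversion_inversion]

/-- The chart `(z, s)` as a function. [folklore] -/
@[simp] theorem zsEquiv_apply (x : BlowupPt) : zsEquiv x = zsFun x := rfl
/-- The inverse of the chart `(z, s)` as a function. [folklore] -/
@[simp] theorem zsEquiv_symm_apply (u : E4) : zsEquiv.symm u = zs (cx u) := rfl
/-- The source of the chart `(z, s)`. [folklore] -/
@[simp] theorem zsEquiv_source : zsEquiv.source = Set.range zs := rfl
/-- The target of the chart `(z, s)` is all of `ℝ⁴`. [folklore] -/
@[simp] theorem zsEquiv_target : zsEquiv.target = univ := rfl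
/-- The chart `(t, w)` as a function. [folklore] -/
@[simp] theorem twEquiv_apply (x : BlowupPt) : twEquiv x = twFun x := rfl
/-- The inverse of the chart `(t, w)` as a function. [folklore] -/
@[simp] theorem twEquiv_symm_apply (u : E4) : twEquiv.symm u = twInv u := rfl
/-- The source of the chart `(t, w)`. [folklore] -/
@[simp] theorem twEquiv_source : twEquiv.source = twSource := rfl
/-- The target of the chart `(t, w)` is all of `ℝ⁴`. [folklore] -/
@[simp] theorem twEquiv_target : twEquiv.target = univ := rfl
/-- The chart at infinity as a function. [folklore] -/
@[simp] theorem infEquiv_apply (x : BlowupPt) : infEquiv x = infFun x := rfl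
/-- The inverse of the chart at infinity as a function. [folklore] -/
@[simp] theorem infEquiv_symm_apply (u : E4) : infEquiv.symm u = infInv u := rfl
/-- The source of the chart at infinity. [folklore] -/
@[simp] theorem infEquiv_source : infEquiv.source = infSource := rfl
/-- The target of the chart at infinity is the open unit ball. [folklore] -/
@[simp] theorem infEquiv_target : infEquiv.target = Metric.ball 0 1 := rfl

/-- `(z, s)`-coordinates of `zs v` are `v`. [folklore] -/
@[simp] theorem zsFun_zs (v : ℂ × ℂ) : zsFun (zs v) = rl v := rfl
/-- `(t, w)`-coordinates of `zs (z, s)` are `(s⁻¹, z s)`. [folklore] -/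
@[simp] theorem twFun_zs (v : ℂ × ℂ) : twFun (zs v) = rl (v.2⁻¹, v.1 * v.2) := rfl
/-- `(t, w)`-coordinates of `ax w` are `(0, w)`. [folklore] -/
@[simp] theorem twFun_ax (w : ℂ) : twFun (ax w) = rl (0, w) := rfl
/-- The chart at infinity is `ι ∘ π` in real coordinates. [folklore] -/
@[simp] theorem infFun_def (x : BlowupPt) : infFun x = inversion (rl (proj x)) := rfl

/-- `π` in the chart `(t, w)`: `π = (t w, w)`. [folklore] -/
theorem proj_twInv (u : E4) : proj (twInv u) = ((cx u).1 * (cx u).2, (cx u).2) := by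
  unfold twInv
  split_ifs with h
  · ext <;> simp [h]
  · simp only [proj_zs]
    ext
    · rfl
    · change (cx u).1 * (cx u).2 * ((cx u).1)⁻¹ = (cx u).2
      field_simp

/-- The point with `(t, w)`-coordinates `u` is a `zs`-point iff `t ≠ 0`. [folklore] -/
theorem twInv_mem_range_zs_iff (u : E4) : twInv u ∈ Set.range zs ↔ (cx u).1 ≠ 0 := by
  unfold twInv
  split_ifs with h
  · simp [h]
  · simp [h]

end BlowupPt

/-! ### Smoothness of the building blocks -/

section Smooth

variable {n : ℕ∞ω}

/-- `cx` is smooth. [folklore] -/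
theorem contDiff_cx : ContDiff ℝ n cx := cxEquiv.contDiff
/-- `rl` is smooth. [folklore] -/
theorem contDiff_rl : ContDiff ℝ n rl := cxEquiv.symm.contDiff
/-- `v ↦ (cx v).1` is smooth. [folklore] -/
theorem contDiff_cx_fst : ContDiff ℝ n fun u : E4 => (cx u).1 := contDiff_fst.comp contDiff_cx
/-- `v ↦ (cx v).2` is smooth. [folklore] -/
theorem contDiff_cx_snd : ContDiff ℝ n fun u : E4 => (cx u).2 := contDiff_snd.comp contDiff_cx

/-- `rl ∘ F` is `C^n` at `u` iff `F` is. [folklore] -/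
theorem contDiffAt_rl_comp_iff {F : E4 → ℂ × ℂ} {u : E4} :
    ContDiffAt ℝ n (fun v => rl (F v)) u ↔ ContDiffAt ℝ n F u :=
  cxEquiv.symm.comp_contDiffAt_iff (f := F)

/-- `ι` in complex coordinates: `cx (ι u) = ‖u‖⁻² • cx u`. [folklore] -/
theorem cx_inversion (u : E4) : cx (inversion u) = ((‖u‖ ^ 2)⁻¹ : ℝ) • cx u := by
  rw [inversion, cx_smul]

/-- First complex coordinate of `ι u`. [folklore] -/
theorem cx_inversion_fst (u : E4) : (cx (inversion u)).1 = ((‖u‖ ^ 2)⁻¹ : ℝ) • (cx u).1 := by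
  rw [cx_inversion]; rfl

/-- Second complex coordinate of `ι u`. [folklore] -/
theorem cx_inversion_snd (u : E4) : (cx (inversion u)).2 = ((‖u‖ ^ 2)⁻¹ : ℝ) • (cx u).2 := by
  rw [cx_inversion]; rfl

/-- `ι` preserves `{z ≠ 0}`. [folklore] -/
theorem cx_inversion_fst_ne_zero_iff (u : E4) : (cx (inversion u)).1 ≠ 0 ↔ (cx u).1 ≠ 0 := by
  rw [cx_inversion_fst, Complex.real_smul, mul_ne_zero_iff, Complex.ofReal_ne_zero]
  constructor
  · exact fun h => h.2
  · intro h
    refine ⟨inv_ne_zero (pow_ne_zero 2 (norm_ne_zero_iff.2 ?_)), h⟩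
    rintro rfl
    simp at h

/-- `ι` preserves `{w ≠ 0}`. [folklore] -/
theorem cx_inversion_snd_ne_zero_iff (u : E4) : (cx (inversion u)).2 ≠ 0 ↔ (cx u).2 ≠ 0 := by
  rw [cx_inversion_snd, Complex.real_smul, mul_ne_zero_iff, Complex.ofReal_ne_zero]
  constructor
  · exact fun h => h.2
  · intro h
    refine ⟨inv_ne_zero (pow_ne_zero 2 (norm_ne_zero_iff.2 ?_)), h⟩
    rintro rfl
    simp at h

/-- `ι` preserves the ratio `z / w`. [folklore] -/
theorem cx_inversion_fst_div_snd (u : E4) :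
    (cx (inversion u)).1 / (cx (inversion u)).2 = (cx u).1 / (cx u).2 := by
  rcases eq_or_ne u 0 with rfl | hu
  · simp
  · rw [cx_inversion_fst, cx_inversion_snd, Complex.real_smul, Complex.real_smul,
      mul_div_mul_left]
    exact_mod_cast inv_ne_zero (pow_ne_zero 2 (norm_ne_zero_iff.2 hu))

/-- `ι` preserves the ratio `w / z`. [folklore] -/
theorem cx_inversion_snd_div_fst (u : E4) :
    (cx (inversion u)).2 / (cx (inversion u)).1 = (cx u).2 / (cx u).1 := by
  rcases eq_or_ne u 0 with rfl | hu
  · simp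
  · rw [cx_inversion_fst, cx_inversion_snd, Complex.real_smul, Complex.real_smul,
      mul_div_mul_left]
    exact_mod_cast inv_ne_zero (pow_ne_zero 2 (norm_ne_zero_iff.2 hu))

/-- The map `(z, s) ↦ (s⁻¹, z s)` (transition `(z,s) → (t,w)`) is smooth where `s ≠ 0`.
[folklore] -/
theorem contDiffAt_transZsTw {u : E4} (hu : (cx u).2 ≠ 0) :
    ContDiffAt ℝ n (fun v : E4 => rl ((cx v).2⁻¹, (cx v).1 * (cx v).2)) u :=
  contDiffAt_rl_comp_iff.2 ((contDiff_cx_snd.contDiffAt.inv hu).prodMk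
    (contDiff_cx_fst.contDiffAt.mul contDiff_cx_snd.contDiffAt))

/-- The map `(t, w) ↦ (t w, t⁻¹)` (transition `(t,w) → (z,s)`) is smooth where `t ≠ 0`.
[folklore] -/
theorem contDiffAt_transTwZs {u : E4} (hu : (cx u).1 ≠ 0) :
    ContDiffAt ℝ n (fun v : E4 => rl ((cx v).1 * (cx v).2, (cx v).1⁻¹)) u :=
  contDiffAt_rl_comp_iff.2 ((contDiff_cx_fst.contDiffAt.mul contDiff_cx_snd.contDiffAt).prodMk
    (contDiff_cx_fst.contDiffAt.inv hu))

/-- `π` in the chart `(z, s)`: `(z, s) ↦ (z, z s)` is smooth. [folklore] -/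
theorem contDiff_projZs : ContDiff ℝ n fun v : E4 => rl ((cx v).1, (cx v).1 * (cx v).2) :=
  contDiff_rl.comp (contDiff_cx_fst.prodMk (contDiff_cx_fst.mul contDiff_cx_snd))

/-- `π` in the chart `(t, w)`: `(t, w) ↦ (t w, w)` is smooth. [folklore] -/
theorem contDiff_projTw : ContDiff ℝ n fun v : E4 => rl ((cx v).1 * (cx v).2, (cx v).2) :=
  contDiff_rl.comp ((contDiff_cx_fst.mul contDiff_cx_snd).prodMk contDiff_cx_snd)

/-- `(z, s)`-coordinates of the point over `y` (off `{y.1 = 0}`): `y ↦ (y.1, y.2 / y.1)`.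
[folklore] -/
theorem contDiffAt_sectZs {u : E4} (hu : (cx u).1 ≠ 0) :
    ContDiffAt ℝ n (fun v : E4 => rl ((cx v).1, (cx v).2 / (cx v).1)) u := by
  simp only [div_eq_mul_inv]
  exact contDiffAt_rl_comp_iff.2 (contDiff_cx_fst.contDiffAt.prodMk
    (contDiff_cx_snd.contDiffAt.mul (contDiff_cx_fst.contDiffAt.inv hu)))

/-- `(t, w)`-coordinates of the point over `y` (off `{y.2 = 0}`): `y ↦ (y.1 / y.2, y.2)`.
[folklore] -/
theorem contDiffAt_sectTw {u : E4} (hu : (cx u).2 ≠ 0) :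
    ContDiffAt ℝ n (fun v : E4 => rl ((cx v).1 / (cx v).2, (cx v).2)) u := by
  simp only [div_eq_mul_inv]
  exact contDiffAt_rl_comp_iff.2 ((contDiff_cx_fst.contDiffAt.mul
    (contDiff_cx_snd.contDiffAt.inv hu)).prodMk contDiff_cx_snd.contDiffAt)

/-- `v ↦ (cx v).1` is continuous. [folklore] -/
theorem continuous_cx_fst : Continuous fun u : E4 => (cx u).1 := (contDiff_cx_fst (n := 0)).continuous
/-- `v ↦ (cx v).2` is continuous. [folklore] -/
theorem continuous_cx_snd : Continuous fun u : E4 => (cx u).2 := (contDiff_cx_snd (n := 0)).continuous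
/-- `π` in the chart `(z, s)` is continuous. [folklore] -/
theorem continuous_projZs : Continuous fun v : E4 => rl ((cx v).1, (cx v).1 * (cx v).2) :=
  (contDiff_projZs (n := 0)).continuous
/-- `π` in the chart `(t, w)` is continuous. [folklore] -/
theorem continuous_projTw : Continuous fun v : E4 => rl ((cx v).1 * (cx v).2, (cx v).2) :=
  (contDiff_projTw (n := 0)).continuous

/-- `{z ≠ 0}` is open in `ℝ⁴`. [folklore] -/
theorem isOpen_cx_fst_ne : IsOpen {u : E4 | (cx u).1 ≠ 0} :=
  isOpen_ne_fun continuous_cx_fst continuous_const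

/-- `{w ≠ 0}` is open in `ℝ⁴`. [folklore] -/
theorem isOpen_cx_snd_ne : IsOpen {u : E4 | (cx u).2 ≠ 0} :=
  isOpen_ne_fun continuous_cx_snd continuous_const

end Smooth

/-! ### The transition maps: sources and smoothness -/

namespace BlowupPt

section Transition

open PartialEquiv

/-- Source of a composite `e.symm.trans e'`. [folklore] -/
theorem symm_trans_source (e e' : PartialEquiv BlowupPt E4) :
    (e.symm.trans e').source = e.target ∩ {u | e.symm u ∈ e'.source} := by
  rw [trans_source, symm_source]; rfl

/-- Source of the transition `(z,s) → (z,s)`. [folklore] -/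
theorem source_zs_zs : (zsEquiv.symm.trans zsEquiv).source = univ := by
  rw [symm_trans_source]; ext u; simp

/-- Source of the transition `(z,s) → (t,w)`: `{s ≠ 0}`. [folklore] -/
theorem source_zs_tw : (zsEquiv.symm.trans twEquiv).source = {u | (cx u).2 ≠ 0} := by
  rw [symm_trans_source]; ext u; simp

/-- Source of the transition `(z,s) → ∞`: `{‖(z, z s)‖ > 1}`. [folklore] -/
theorem source_zs_inf : (zsEquiv.symm.trans infEquiv).source = {u | 1 < ‖rl ((cx u).1, (cx u).1 * (cx u).2)‖} := by
  rw [symm_trans_source]; ext u; simp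

/-- Source of the transition `(t,w) → (z,s)`: `{t ≠ 0}`. [folklore] -/
theorem source_tw_zs : (twEquiv.symm.trans zsEquiv).source = {u | (cx u).1 ≠ 0} := by
  rw [symm_trans_source]; ext u
  simp only [twEquiv_target, twEquiv_symm_apply, zsEquiv_source, univ_inter, mem_setOf_eq]
  exact twInv_mem_range_zs_iff u

/-- Source of the transition `(t,w) → (t,w)`. [folklore] -/
theorem source_tw_tw : (twEquiv.symm.trans twEquiv).source = univ := by
  rw [symm_trans_source]; ext u
  simp only [twEquiv_target, univ_inter, mem_setOf_eq, mem_univ, iff_true]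
  exact twEquiv.map_target (mem_univ _)

/-- The inverse chart `(t, w)` never takes the value `∞`. [folklore] -/
theorem twInv_ne_inf (u : E4) : twInv u ≠ inf := by
  unfold twInv; split_ifs <;> simp

/-- Source of the transition `(t,w) → ∞`: `{‖(t w, w)‖ > 1}`. [folklore] -/
theorem source_tw_inf : (twEquiv.symm.trans infEquiv).source = {u | 1 < ‖rl ((cx u).1 * (cx u).2, (cx u).2)‖} := by
  rw [symm_trans_source]; ext u
  simp only [twEquiv_target, twEquiv_symm_apply, infEquiv_source, univ_inter, mem_setOf_eq]
  rw [mem_infSource_of_ne (twInv_ne_inf u), proj_twInv]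

/-- `sect y` is a `zs`-point iff `y.1 ≠ 0`. [folklore] -/
theorem sect_mem_range_zs_iff (y : ℂ × ℂ) : sect y ∈ Set.range zs ↔ y.1 ≠ 0 := by
  unfold sect; split_ifs with h <;> simp [h]

/-- The inverse chart at infinity lands in the `zs`-points iff `z ≠ 0`. [folklore] -/
theorem infInv_mem_range_zs_iff (u : E4) : infInv u ∈ Set.range zs ↔ (cx u).1 ≠ 0 := by
  unfold infInv
  split_ifs with h
  · subst h; simp
  · rw [sect_mem_range_zs_iff, cx_inversion_fst_ne_zero_iff]

/-- Source of the transition `∞ → (z,s)`: the unit ball with `{z ≠ 0}`. [folklore] -/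
theorem source_inf_zs : (infEquiv.symm.trans zsEquiv).source = Metric.ball 0 1 ∩ {u | (cx u).1 ≠ 0} := by
  rw [symm_trans_source]; ext u
  simp only [infEquiv_target, infEquiv_symm_apply, zsEquiv_source, mem_inter_iff, mem_setOf_eq]
  rw [infInv_mem_range_zs_iff]

/-- `sect y`, `y ≠ 0`, is in the source of `(t, w)` iff `y.2 ≠ 0`. [folklore] -/
theorem sect_mem_twSource_iff {y : ℂ × ℂ} (hy : y ≠ 0) : sect y ∈ twSource ↔ y.2 ≠ 0 := by
  unfold sect
  split_ifs with h
  · simp only [ax_mem_twSource, true_iff]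
    intro h2; exact hy (Prod.ext h h2)
  · simp [h]

/-- The inverse chart at infinity lands in the source of `(t, w)` iff `w ≠ 0`. [folklore] -/
theorem infInv_mem_twSource_iff (u : E4) : infInv u ∈ twSource ↔ (cx u).2 ≠ 0 := by
  unfold infInv
  split_ifs with h
  · subst h; simp
  · have hy : cx (inversion u) ≠ 0 := by
      rw [Ne, cx_eq_zero]; exact inversion_ne_zero h
    rw [sect_mem_twSource_iff hy, cx_inversion_snd_ne_zero_iff]

/-- Source of the transition `∞ → (t,w)`: the unit ball with `{w ≠ 0}`. [folklore] -/
theorem source_inf_tw : (infEquiv.symm.trans twEquiv).source = Metric.ball 0 1 ∩ {u | (cx u).2 ≠ 0} := by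
  rw [symm_trans_source]; ext u
  simp only [infEquiv_target, infEquiv_symm_apply, twEquiv_source, mem_inter_iff, mem_setOf_eq]
  rw [infInv_mem_twSource_iff]

/-- Source of the transition `∞ → ∞`: the unit ball. [folklore] -/
theorem source_inf_inf : (infEquiv.symm.trans infEquiv).source = Metric.ball 0 1 := by
  rw [symm_trans_source]; ext u
  simp only [infEquiv_target, mem_inter_iff, mem_setOf_eq, and_iff_left_iff_imp]
  exact fun hu => infEquiv.map_target hu

/-! Smoothness. -/

/-- The transition `(z,s) → (z,s)` (the identity) is smooth. [folklore] -/
theorem contDiffOn_zs_zs : ContDiffOn ℝ ∞ (zsEquiv.symm.trans zsEquiv) (zsEquiv.symm.trans zsEquiv).source := by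
  apply contDiffOn_id.congr
  intro u _
  simp [zsFun]

/-- The transition `(z,s) → (t,w) = (s⁻¹, z s)` is smooth (holomorphic). [folklore] -/
theorem contDiffOn_zs_tw : ContDiffOn ℝ ∞ (zsEquiv.symm.trans twEquiv) (zsEquiv.symm.trans twEquiv).source := by
  rw [source_zs_tw]
  intro u hu
  exact (contDiffAt_transZsTw hu).contDiffWithinAt.congr (fun v _ => by simp) (by simp)

/-- A vector of norm `> 1` is non-zero. [folklore] -/
theorem one_lt_norm_imp_ne_zero {v : E4} (h : 1 < ‖v‖) : v ≠ 0 := by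
  rintro rfl; norm_num at h

/-- The transition `(z,s) → ∞`, `ι (z, z s)`, is smooth. [folklore] -/
theorem contDiffOn_zs_inf : ContDiffOn ℝ ∞ (zsEquiv.symm.trans infEquiv) (zsEquiv.symm.trans infEquiv).source := by
  rw [source_zs_inf]
  intro u hu
  have h := ((contDiffAt_inversion (n := ∞) (one_lt_norm_imp_ne_zero hu)).comp u
    contDiff_projZs.contDiffAt).contDiffWithinAt (s := {u | 1 < ‖rl ((cx u).1, (cx u).1 * (cx u).2)‖})
  exact h.congr (fun v _ => by simp) (by simp)

/-- The transition `(t,w) → (z,s) = (t w, t⁻¹)` is smooth (holomorphic). [folklore] -/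
theorem contDiffOn_tw_zs : ContDiffOn ℝ ∞ (twEquiv.symm.trans zsEquiv) (twEquiv.symm.trans zsEquiv).source := by
  rw [source_tw_zs]
  intro u hu
  have key : ∀ v : E4, (cx v).1 ≠ 0 →
      (twEquiv.symm.trans zsEquiv) v = rl ((cx v).1 * (cx v).2, (cx v).1⁻¹) := by
    intro v hv
    simp [twInv, hv, zsFun]
  exact (contDiffAt_transTwZs hu).contDiffWithinAt.congr (fun v hv => key v hv) (key u hu)

/-- The transition `(t,w) → (t,w)` (the identity) is smooth. [folklore] -/
theorem contDiffOn_tw_tw : ContDiffOn ℝ ∞ (twEquiv.symm.trans twEquiv) (twEquiv.symm.trans twEquiv).source := by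
  apply contDiffOn_id.congr
  intro u _
  exact twEquiv.right_inv (mem_univ _)

/-- The transition `(t,w) → ∞`, `ι (t w, w)`, is smooth. [folklore] -/
theorem contDiffOn_tw_inf : ContDiffOn ℝ ∞ (twEquiv.symm.trans infEquiv) (twEquiv.symm.trans infEquiv).source := by
  rw [source_tw_inf]
  intro u hu
  have key : ∀ v : E4, (twEquiv.symm.trans infEquiv) v = inversion (rl ((cx v).1 * (cx v).2, (cx v).2)) := by
    intro v
    simp [proj_twInv]
  have h := ((contDiffAt_inversion (n := ∞) (one_lt_norm_imp_ne_zero hu)).comp u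
    contDiff_projTw.contDiffAt).contDiffWithinAt (s := {u | 1 < ‖rl ((cx u).1 * (cx u).2, (cx u).2)‖})
  exact h.congr (fun v _ => by rw [key]; rfl) (by rw [key]; rfl)

/-- Off the origin the inverse chart at infinity is `sect ∘ ι`. [folklore] -/
theorem infInv_eq_sect {u : E4} (hu : u ≠ 0) : infInv u = sect (cx (inversion u)) := if_neg hu

/-- The transition `∞ → (z,s)`, `(y¹, y²/y¹) ∘ ι`, is smooth. [folklore] -/
theorem contDiffOn_inf_zs : ContDiffOn ℝ ∞ (infEquiv.symm.trans zsEquiv) (infEquiv.symm.trans zsEquiv).source := by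
  rw [source_inf_zs]
  intro u hu
  have hu1 : (cx u).1 ≠ 0 := hu.2
  have hu0 : u ≠ 0 := by rintro rfl; simp at hu1
  have key : ∀ v : E4, (cx v).1 ≠ 0 →
      (infEquiv.symm.trans zsEquiv) v = rl ((cx (inversion v)).1, (cx (inversion v)).2 / (cx (inversion v)).1) := by
    intro v hv
    have hv0 : v ≠ 0 := by rintro rfl; simp at hv
    have hv' : (cx (inversion v)).1 ≠ 0 := (cx_inversion_fst_ne_zero_iff v).2 hv
    simp [infInv_eq_sect hv0, sect_of_fst_ne_zero hv', zsFun]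
  have h := ((contDiffAt_sectZs (n := ∞) ((cx_inversion_fst_ne_zero_iff u).2 hu1)).comp u
    (contDiffAt_inversion hu0)).contDiffWithinAt (s := Metric.ball 0 1 ∩ {u | (cx u).1 ≠ 0})
  exact h.congr (fun v hv => key v hv.2) (key u hu1)

/-- The transition `∞ → (t,w)`, `(y¹/y², y²) ∘ ι`, is smooth. [folklore] -/
theorem contDiffOn_inf_tw : ContDiffOn ℝ ∞ (infEquiv.symm.trans twEquiv) (infEquiv.symm.trans twEquiv).source := by
  rw [source_inf_tw]
  intro u hu
  have hu2 : (cx u).2 ≠ 0 := hu.2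
  have hu0 : u ≠ 0 := by rintro rfl; simp at hu2
  have key : ∀ v : E4, (cx v).2 ≠ 0 →
      (infEquiv.symm.trans twEquiv) v = rl ((cx (inversion v)).1 / (cx (inversion v)).2, (cx (inversion v)).2) := by
    intro v hv
    have hv0 : v ≠ 0 := by rintro rfl; simp at hv
    have hv' : (cx (inversion v)).2 ≠ 0 := (cx_inversion_snd_ne_zero_iff v).2 hv
    rw [PartialEquiv.coe_trans, Function.comp_apply, infEquiv_symm_apply, infInv_eq_sect hv0, twEquiv_apply]
    by_cases h1 : (cx (inversion v)).1 = 0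
    · rw [sect_of_fst_eq_zero h1, twFun_ax, h1, zero_div]
    · rw [sect_of_fst_ne_zero h1, twFun_zs]
      congr 1
      ext
      · simp [inv_div]
      · change (cx (inversion v)).1 * ((cx (inversion v)).2 / (cx (inversion v)).1) = _
        field_simp
  have h := ((contDiffAt_sectTw (n := ∞) ((cx_inversion_snd_ne_zero_iff u).2 hu2)).comp u
    (contDiffAt_inversion hu0)).contDiffWithinAt (s := Metric.ball 0 1 ∩ {u | (cx u).2 ≠ 0})
  exact h.congr (fun v hv => key v hv.2) (key u hu2)

/-- The transition `∞ → ∞` (the identity on the ball) is smooth. [folklore] -/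
theorem contDiffOn_inf_inf : ContDiffOn ℝ ∞ (infEquiv.symm.trans infEquiv) (infEquiv.symm.trans infEquiv).source := by
  rw [source_inf_inf]
  apply contDiffOn_id.congr
  intro u hu
  exact infEquiv.right_inv hu

/-! Openness of the sources. -/

/-- The source of the transition `(z,s) → ∞` is open. [folklore] -/
theorem isOpen_source_zs_inf : IsOpen (zsEquiv.symm.trans infEquiv).source := by
  rw [source_zs_inf]
  exact isOpen_lt continuous_const (continuous_norm.comp continuous_projZs)

/-- The source of the transition `(t,w) → ∞` is open. [folklore] -/
theorem isOpen_source_tw_inf : IsOpen (twEquiv.symm.trans infEquiv).source := by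
  rw [source_tw_inf]
  exact isOpen_lt continuous_const (continuous_norm.comp continuous_projTw)

end Transition

/-! ### The charted space structure (topology generated by the charts) -/

/-- The atlas `{zsEquiv, twEquiv, infEquiv}` of `Bl₀(ℂ²) ∪ {∞}`, with the topology it generates.
[folklore] -/
def core : ChartedSpaceCore E4 BlowupPt where
  atlas := {zsEquiv, twEquiv, infEquiv}
  chartAt x := match x with
    | zs _ => zsEquiv
    | ax _ => twEquiv
    | inf => infEquiv
  mem_chart_source x := by
    rcases x with v | w | _
    · exact ⟨v, rfl⟩
    · exact ax_mem_twSource w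
    · exact inf_mem_infSource
  chart_mem_atlas x := by
    rcases x with v | w | _ <;> simp
  open_source := by
    rintro e e' (rfl | rfl | rfl) (rfl | rfl | rfl)
    · rw [source_zs_zs]; exact isOpen_univ
    · rw [source_zs_tw]; exact isOpen_cx_snd_ne
    · exact isOpen_source_zs_inf
    · rw [source_tw_zs]; exact isOpen_cx_fst_ne
    · rw [source_tw_tw]; exact isOpen_univ
    · exact isOpen_source_tw_inf
    · rw [source_inf_zs]; exact Metric.isOpen_ball.inter isOpen_cx_fst_ne
    · rw [source_inf_tw]; exact Metric.isOpen_ball.inter isOpen_cx_snd_ne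
    · rw [source_inf_inf]; exact Metric.isOpen_ball
  continuousOn_toFun := by
    rintro e e' (rfl | rfl | rfl) (rfl | rfl | rfl)
    · exact contDiffOn_zs_zs.continuousOn
    · exact contDiffOn_zs_tw.continuousOn
    · exact contDiffOn_zs_inf.continuousOn
    · exact contDiffOn_tw_zs.continuousOn
    · exact contDiffOn_tw_tw.continuousOn
    · exact contDiffOn_tw_inf.continuousOn
    · exact contDiffOn_inf_zs.continuousOn
    · exact contDiffOn_inf_tw.continuousOn
    · exact contDiffOn_inf_inf.continuousOn

/-- All nine transition maps of the atlas are smooth. [folklore] -/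
theorem contDiffOn_of_mem_atlas {e e' : PartialEquiv BlowupPt E4} (he : e ∈ core.atlas) (he' : e' ∈ core.atlas) :
    ContDiffOn ℝ ∞ (e.symm.trans e') (e.symm.trans e').source := by
  rcases he with rfl | rfl | rfl <;> rcases he' with rfl | rfl | rfl
  · exact contDiffOn_zs_zs
  · exact contDiffOn_zs_tw
  · exact contDiffOn_zs_inf
  · exact contDiffOn_tw_zs
  · exact contDiffOn_tw_tw
  · exact contDiffOn_tw_inf
  · exact contDiffOn_inf_zs
  · exact contDiffOn_inf_tw
  · exact contDiffOn_inf_inf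

/-- The topology of `Bl₀(ℂ²) ∪ {∞}` generated by the three charts. [folklore] -/
instance instTopologicalSpace : TopologicalSpace BlowupPt := core.toTopologicalSpace

/-- `Bl₀(ℂ²) ∪ {∞}` is charted on `ℝ⁴` by `{(z,s), (t,w), ι ∘ π}`. [folklore] -/
instance instChartedSpace : ChartedSpace E4 BlowupPt := core.toChartedSpace

/-- The three charts as open partial homeomorphisms. [folklore] -/
def zsChart : OpenPartialHomeomorph BlowupPt E4 := core.openPartialHomeomorph zsEquiv (Or.inl rfl)
/-- The chart `(t, w)` as an open partial homeomorphism. [folklore] -/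
def twChart : OpenPartialHomeomorph BlowupPt E4 := core.openPartialHomeomorph twEquiv (Or.inr (Or.inl rfl))
/-- The chart at infinity `ι ∘ π` as an open partial homeomorphism. [folklore] -/
def infChart : OpenPartialHomeomorph BlowupPt E4 := core.openPartialHomeomorph infEquiv (Or.inr (Or.inr rfl))

/-- The preferred chart at a `zs`-point is `(z, s)`. [folklore] -/
@[simp] theorem chartAt_zs (v : ℂ × ℂ) : chartAt E4 (zs v) = zsChart := rfl
/-- The preferred chart at an `ax`-point is `(t, w)`. [folklore] -/
@[simp] theorem chartAt_ax (w : ℂ) : chartAt E4 (ax w) = twChart := rfl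
/-- The preferred chart at `∞` is `ι ∘ π`. [folklore] -/
@[simp] theorem chartAt_inf : chartAt E4 inf = infChart := rfl

/-- Underlying partial equivalence of the chart `(z, s)`. [folklore] -/
@[simp] theorem zsChart_toPartialEquiv : zsChart.toPartialEquiv = zsEquiv := rfl
/-- Underlying partial equivalence of the chart `(t, w)`. [folklore] -/
@[simp] theorem twChart_toPartialEquiv : twChart.toPartialEquiv = twEquiv := rfl
/-- Underlying partial equivalence of the chart at infinity. [folklore] -/
@[simp] theorem infChart_toPartialEquiv : infChart.toPartialEquiv = infEquiv := rfl
/-- The chart `(z, s)` as a function. [folklore] -/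
@[simp] theorem zsChart_apply (x : BlowupPt) : zsChart x = zsFun x := rfl
/-- Inverse of the chart `(z, s)` as a function. [folklore] -/
@[simp] theorem zsChart_symm_apply (u : E4) : zsChart.symm u = zs (cx u) := rfl
/-- Source of the chart `(z, s)`. [folklore] -/
@[simp] theorem zsChart_source : zsChart.source = Set.range zs := rfl
/-- Target of the chart `(z, s)`. [folklore] -/
@[simp] theorem zsChart_target : zsChart.target = univ := rfl
/-- The chart `(t, w)` as a function. [folklore] -/
@[simp] theorem twChart_apply (x : BlowupPt) : twChart x = twFun x := rfl
/-- Inverse of the chart `(t, w)` as a function. [folklore] -/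
@[simp] theorem twChart_symm_apply (u : E4) : twChart.symm u = twInv u := rfl
/-- Source of the chart `(t, w)`. [folklore] -/
@[simp] theorem twChart_source : twChart.source = twSource := rfl
/-- Target of the chart `(t, w)`. [folklore] -/
@[simp] theorem twChart_target : twChart.target = univ := rfl
/-- The chart at infinity as a function. [folklore] -/
@[simp] theorem infChart_apply (x : BlowupPt) : infChart x = infFun x := rfl
/-- Inverse of the chart at infinity as a function. [folklore] -/
@[simp] theorem infChart_symm_apply (u : E4) : infChart.symm u = infInv u := rfl
/-- Source of the chart at infinity. [folklore] -/
@[simp] theorem infChart_source : infChart.source = infSource := rfl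
/-- Target of the chart at infinity. [folklore] -/
@[simp] theorem infChart_target : infChart.target = Metric.ball 0 1 := rfl

/-- The atlas consists of the three charts. [folklore] -/
theorem mem_atlas_iff (e : OpenPartialHomeomorph BlowupPt E4) :
    e ∈ atlas E4 BlowupPt ↔ ∃ (e₀ : PartialEquiv BlowupPt E4) (h : e₀ ∈ core.atlas), e = core.openPartialHomeomorph e₀ h := by
  change e ∈ ⋃ (e₀ : PartialEquiv BlowupPt E4) (he : e₀ ∈ core.atlas), {core.openPartialHomeomorph e₀ he} ↔ _
  simp only [mem_iUnion, mem_singleton_iff]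

/-- `Bl₀(ℂ²) ∪ {∞}` is a smooth `4`-manifold. [folklore] -/
instance instIsManifold : IsManifold (𝓡 4) ∞ BlowupPt := by
  apply isManifold_of_contDiffOn
  intro e e' he he'
  obtain ⟨e₀, h₀, rfl⟩ := (mem_atlas_iff e).1 he
  obtain ⟨e₀', h₀', rfl⟩ := (mem_atlas_iff e').1 he'
  have h := contDiffOn_of_mem_atlas h₀ h₀'
  simp only [modelWithCornersSelf_coe, modelWithCornersSelf_coe_symm, Function.comp_id,
    Function.id_comp, range_id, inter_univ, preimage_id_eq, id_eq]
  exact h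

/-! ### Topology: the charts are homeomorphisms; `T₂`, second countable, compact -/

/-- The `zs`-points form an open set. [folklore] -/
theorem isOpen_range_zs : IsOpen (Set.range zs) := zsChart.open_source
/-- The source of `(t, w)` is open. [folklore] -/
theorem isOpen_twSource : IsOpen twSource := twChart.open_source
/-- The source of the chart at infinity is open. [folklore] -/
theorem isOpen_infSource : IsOpen infSource := infChart.open_source

/-- `zs : ℂ² → M` is continuous (inverse of a chart). [folklore] -/
theorem continuous_zs : Continuous zs := by
  have h : Continuous fun u : E4 => zs (cx u) :=
    (continuousOn_univ (f := (zsChart.symm : E4 → BlowupPt))).1 zsChart.continuousOn_symm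
  simpa [Function.comp_def] using h.comp continuous_rl

/-- The inverse of the chart `(t, w)` is continuous. [folklore] -/
theorem continuous_twInv : Continuous twInv :=
  (continuousOn_univ (f := (twChart.symm : E4 → BlowupPt))).1 twChart.continuousOn_symm

/-- `ax : ℂ → M` is continuous. [folklore] -/
theorem continuous_ax : Continuous ax := by
  have : (fun w : ℂ => twInv (rl (0, w))) = ax := by
    funext w; simp [twInv]
  rw [← this]
  exact continuous_twInv.comp (continuous_rl.comp (continuous_const.prodMk continuous_id))

/-- The inverse of the chart at infinity is continuous on the unit ball. [folklore] -/
theorem continuousOn_infInv : ContinuousOn infInv (Metric.ball 0 1) :=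
  infChart.continuousOn_symm

/-- A chart preimage of an open set is open. [folklore] -/
theorem isOpen_preimage_chart (e : OpenPartialHomeomorph BlowupPt E4) {U : Set E4} (hU : IsOpen U) :
    IsOpen (e.source ∩ e ⁻¹' U) :=
  e.continuousOn.isOpen_inter_preimage e.open_source hU

/-- Two distinct points in the source of one chart are separated. [folklore] -/
theorem separated_of_mem_chart (e : OpenPartialHomeomorph BlowupPt E4) {x y : BlowupPt} (hx : x ∈ e.source)
    (hy : y ∈ e.source) (hxy : x ≠ y) :
    ∃ U V : Set BlowupPt, IsOpen U ∧ IsOpen V ∧ x ∈ U ∧ y ∈ V ∧ Disjoint U V := by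
  have hne : e x ≠ e y := fun h => hxy (e.injOn hx hy h)
  obtain ⟨U, V, hU, hV, hxU, hyV, hUV⟩ := t2_separation hne
  refine ⟨e.source ∩ e ⁻¹' U, e.source ∩ e ⁻¹' V, isOpen_preimage_chart e hU,
    isOpen_preimage_chart e hV, ⟨hx, hxU⟩, ⟨hy, hyV⟩, ?_⟩
  rw [Set.disjoint_left]
  rintro z ⟨_, hzU⟩ ⟨_, hzV⟩
  exact Set.disjoint_left.1 hUV hzU hzV

/-- The open set `{zs (z, s) | |s| < 1}` (contains `E ∖ [0:1]`-side points and the `z`-axis).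
[folklore] -/
def slabZs : Set BlowupPt := zsChart.source ∩ zsChart ⁻¹' {u | ‖(cx u).2‖ < 1}
/-- The open set `{(t, w) | |t| < 1}`. [folklore] -/
def slabTw : Set BlowupPt := twChart.source ∩ twChart ⁻¹' {u | ‖(cx u).1‖ < 1}

/-- `{zs (z, s) | |s| < 1}` is open. [folklore] -/
theorem isOpen_slabZs : IsOpen slabZs :=
  isOpen_preimage_chart _ (isOpen_lt (continuous_norm.comp continuous_cx_snd) continuous_const)

/-- `{(t, w) | |t| < 1}` is open. [folklore] -/
theorem isOpen_slabTw : IsOpen slabTw :=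
  isOpen_preimage_chart _ (isOpen_lt (continuous_norm.comp continuous_cx_fst) continuous_const)

/-- Membership in `{zs (z, s) | |s| < 1}`. [folklore] -/
theorem zs_mem_slabZs_iff (v : ℂ × ℂ) : zs v ∈ slabZs ↔ ‖v.2‖ < 1 := by
  simp [slabZs]

/-- Membership in `{(t, w) | |t| < 1}`. [folklore] -/
theorem mem_slabTw_iff (x : BlowupPt) : x ∈ slabTw ↔ x ∈ twSource ∧ ‖(cx (twFun x)).1‖ < 1 := Iff.rfl

/-- The slabs `{|s| < 1}` and `{|t| < 1}` (`t = s⁻¹`) are disjoint: they separate `[1:0]`-side from `[0:1]`-side points. [folklore] -/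
theorem disjoint_slabZs_slabTw : Disjoint slabZs slabTw := by
  rw [Set.disjoint_left]
  rintro (v | w | _) h1 h2
  · rw [zs_mem_slabZs_iff] at h1
    rw [mem_slabTw_iff, zs_mem_twSource, twFun_zs, cx_rl] at h2
    obtain ⟨hs, ht⟩ := h2
    have : ‖v.2⁻¹‖ < 1 := ht
    rw [norm_inv] at this
    rcases inv_lt_one_iff₀.1 this with h | h
    · exact absurd h (not_le.2 (norm_pos_iff.2 hs))
    · exact absurd h1 (not_lt.2 h.le)
  · exact absurd h1.1 (by rintro ⟨v, hv⟩; cases hv)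
  · exact absurd h1.1 (by rintro ⟨v, hv⟩; cases hv)

/-- Norm of `rl (a, b)` controls `‖a‖`. [folklore] -/
theorem norm_fst_le_norm_rl (q : ℂ × ℂ) : ‖q.1‖ ≤ ‖rl q‖ := by
  rw [← pow_le_pow_iff_left₀ (norm_nonneg _) (norm_nonneg _) two_ne_zero, norm_rl_sq,
    Complex.normSq_eq_norm_sq, Complex.normSq_eq_norm_sq]
  nlinarith [sq_nonneg ‖q.2‖]

/-- Norm of `rl (a, b)` controls `‖b‖`. [folklore] -/
theorem norm_snd_le_norm_rl (q : ℂ × ℂ) : ‖q.2‖ ≤ ‖rl q‖ := by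
  rw [← pow_le_pow_iff_left₀ (norm_nonneg _) (norm_nonneg _) two_ne_zero, norm_rl_sq,
    Complex.normSq_eq_norm_sq, Complex.normSq_eq_norm_sq]
  nlinarith [sq_nonneg ‖q.1‖]

/-- `‖rl (0, w)‖ = ‖w‖`. [folklore] -/
theorem norm_rl_zero_left (w : ℂ) : ‖rl (0, w)‖ = ‖w‖ := by
  rw [← sq_eq_sq₀ (norm_nonneg _) (norm_nonneg _), norm_rl_sq, Complex.normSq_eq_norm_sq,
    Complex.normSq_eq_norm_sq]
  simp

/-- `‖rl (a, b)‖ ≤ |A| + |B|` when `‖a‖ ≤ A`, `‖b‖ ≤ B`. [folklore] -/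
theorem norm_rl_le (q : ℂ × ℂ) {a b : ℝ} (ha : ‖q.1‖ ≤ a) (hb : ‖q.2‖ ≤ b) :
    ‖rl q‖ ≤ |a| + |b| := by
  have h0 : 0 ≤ |a| + |b| := by positivity
  rw [← pow_le_pow_iff_left₀ (norm_nonneg _) h0 two_ne_zero, norm_rl_sq,
    Complex.normSq_eq_norm_sq, Complex.normSq_eq_norm_sq]
  have ha' : ‖q.1‖ ≤ |a| := ha.trans (le_abs_self a)
  have hb' : ‖q.2‖ ≤ |b| := hb.trans (le_abs_self b)
  nlinarith [norm_nonneg q.1, norm_nonneg q.2, abs_nonneg a, abs_nonneg b]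

/-- On the source of `twEquiv`, `π` is read off the chart: `π = P_tw ∘ (t, w)`. [folklore] -/
theorem proj_eq_of_mem_twSource {x : BlowupPt} (hx : x ∈ twSource) :
    proj x = ((cx (twFun x)).1 * (cx (twFun x)).2, (cx (twFun x)).2) := by
  have h := proj_twInv (twFun x)
  rwa [show twInv (twFun x) = x from twEquiv.left_inv hx] at h

/-- The open set `{x ∈ source twEquiv | ‖π x‖ < 2}`. [folklore] -/
def nearTw : Set BlowupPt := twChart.source ∩ twChart ⁻¹' {u | ‖rl ((cx u).1 * (cx u).2, (cx u).2)‖ < 2}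
/-- The open set `{zs v | ‖π (zs v)‖ < 2}`. [folklore] -/
def nearZs : Set BlowupPt := zsChart.source ∩ zsChart ⁻¹' {u | ‖rl ((cx u).1, (cx u).1 * (cx u).2)‖ < 2}
/-- The open set `{‖π x‖ > 2} ∪ {∞}`. [folklore] -/
def nearInf : Set BlowupPt := infChart.source ∩ infChart ⁻¹' Metric.ball 0 2⁻¹

/-- `{x ∈ source (t,w) | ‖π x‖ < 2}` is open. [folklore] -/
theorem isOpen_nearTw : IsOpen nearTw :=
  isOpen_preimage_chart _ (isOpen_lt (continuous_norm.comp continuous_projTw) continuous_const)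
/-- `{zs v | ‖π (zs v)‖ < 2}` is open. [folklore] -/
theorem isOpen_nearZs : IsOpen nearZs :=
  isOpen_preimage_chart _ (isOpen_lt (continuous_norm.comp continuous_projZs) continuous_const)
/-- `{‖π x‖ > 2} ∪ {∞}` is open. [folklore] -/
theorem isOpen_nearInf : IsOpen nearInf := isOpen_preimage_chart _ Metric.isOpen_ball

/-- `∞ ∈ {‖π x‖ > 2} ∪ {∞}`. [folklore] -/
theorem inf_mem_nearInf : inf ∈ nearInf := ⟨inf_mem_infSource, by simp [infFun]⟩

/-- `‖π‖ < 2` on `nearTw`. [folklore] -/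
theorem norm_proj_lt_of_mem_nearTw {x : BlowupPt} (hx : x ∈ nearTw) : ‖rl (proj x)‖ < 2 := by
  obtain ⟨h1, h2⟩ := hx
  rw [proj_eq_of_mem_twSource h1]
  exact h2

/-- `‖π‖ < 2` on `nearZs`. [folklore] -/
theorem norm_proj_lt_of_mem_nearZs {x : BlowupPt} (hx : x ∈ nearZs) : ‖rl (proj x)‖ < 2 := by
  obtain ⟨⟨v, rfl⟩, h2⟩ := hx
  simpa using h2

/-- `‖π‖ > 2` on `nearInf ∖ {∞}`. [folklore] -/
theorem two_lt_norm_proj_of_mem_nearInf {x : BlowupPt} (hx : x ∈ nearInf) (hne : x ≠ inf) : 2 < ‖rl (proj x)‖ := by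
  obtain ⟨h1, h2⟩ := hx
  have hpos := norm_rl_proj_pos_of_mem_infSource h1 hne
  have h3 : ‖infFun x‖ < 2⁻¹ := by simpa using h2
  rw [infFun, norm_inversion] at h3
  exact (inv_lt_inv₀ hpos two_pos).1 h3

/-- `nearTw` and `nearInf` are disjoint. [folklore] -/
theorem disjoint_nearTw_nearInf : Disjoint nearTw nearInf := by
  rw [Set.disjoint_left]
  intro x h1 h2
  have hne : x ≠ inf := by rintro rfl; exact inf_not_mem_twSource h1.1
  exact absurd (norm_proj_lt_of_mem_nearTw h1) (not_lt.2 (two_lt_norm_proj_of_mem_nearInf h2 hne).le)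

/-- `nearZs` and `nearInf` are disjoint. [folklore] -/
theorem disjoint_nearZs_nearInf : Disjoint nearZs nearInf := by
  rw [Set.disjoint_left]
  intro x h1 h2
  have hne : x ≠ inf := by rintro rfl; obtain ⟨⟨v, hv⟩, _⟩ := h1; cases hv
  exact absurd (norm_proj_lt_of_mem_nearZs h1) (not_lt.2 (two_lt_norm_proj_of_mem_nearInf h2 hne).le)

/-- Separation by open sets is symmetric. [folklore] -/
theorem sep_symm {x y : BlowupPt} :
    (∃ U V : Set BlowupPt, IsOpen U ∧ IsOpen V ∧ x ∈ U ∧ y ∈ V ∧ Disjoint U V) →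
      ∃ U V : Set BlowupPt, IsOpen U ∧ IsOpen V ∧ y ∈ U ∧ x ∈ V ∧ Disjoint U V := by
  rintro ⟨U, V, hU, hV, hx, hy, hUV⟩
  exact ⟨V, U, hV, hU, hy, hx, hUV.symm⟩

/-- A `zs`-point and an `ax`-point are separated by open sets. [folklore] -/
theorem sep_zs_ax (v : ℂ × ℂ) (w : ℂ) :
    ∃ U V : Set BlowupPt, IsOpen U ∧ IsOpen V ∧ zs v ∈ U ∧ ax w ∈ V ∧ Disjoint U V := by
  by_cases hs : v.2 = 0
  · refine ⟨slabZs, slabTw, isOpen_slabZs, isOpen_slabTw, (zs_mem_slabZs_iff v).2 (by simp [hs]), ?_,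
      disjoint_slabZs_slabTw⟩
    exact ⟨ax_mem_twSource w, by simp⟩
  · exact separated_of_mem_chart twChart ((zs_mem_twSource v).2 hs) (ax_mem_twSource w) (by simp)

/-- A `zs`-point and `∞` are separated by open sets. [folklore] -/
theorem sep_zs_inf (v : ℂ × ℂ) :
    ∃ U V : Set BlowupPt, IsOpen U ∧ IsOpen V ∧ zs v ∈ U ∧ inf ∈ V ∧ Disjoint U V := by
  by_cases h : 1 < ‖rl (v.1, v.1 * v.2)‖
  · exact separated_of_mem_chart infChart ((zs_mem_infSource v).2 h) inf_mem_infSource (by simp)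
  · refine ⟨nearZs, nearInf, isOpen_nearZs, isOpen_nearInf, ⟨⟨v, rfl⟩, ?_⟩, inf_mem_nearInf, disjoint_nearZs_nearInf⟩
    have : ‖rl (v.1, v.1 * v.2)‖ < 2 := lt_of_le_of_lt (not_lt.1 h) one_lt_two
    simpa using this

/-- An `ax`-point and `∞` are separated by open sets. [folklore] -/
theorem sep_ax_inf (w : ℂ) :
    ∃ U V : Set BlowupPt, IsOpen U ∧ IsOpen V ∧ ax w ∈ U ∧ inf ∈ V ∧ Disjoint U V := by
  by_cases h : 1 < ‖rl ((0 : ℂ), w)‖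
  · exact separated_of_mem_chart infChart ((ax_mem_infSource w).2 h) inf_mem_infSource (by simp)
  · refine ⟨nearTw, nearInf, isOpen_nearTw, isOpen_nearInf, ⟨ax_mem_twSource w, ?_⟩, inf_mem_nearInf,
      disjoint_nearTw_nearInf⟩
    have : ‖rl ((0 : ℂ), w)‖ < 2 := lt_of_le_of_lt (not_lt.1 h) one_lt_two
    simpa using this

/-- `Bl₀(ℂ²) ∪ {∞}` is Hausdorff. [folklore] -/
instance instT2Space : T2Space BlowupPt := by
  refine ⟨fun x y hxy => ?_⟩
  rcases x with v | w | _ <;> rcases y with v' | w' | _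
  · exact separated_of_mem_chart zsChart ⟨v, rfl⟩ ⟨v', rfl⟩ hxy
  · exact sep_zs_ax v w'
  · exact sep_zs_inf v
  · exact sep_symm (sep_zs_ax v' w)
  · exact separated_of_mem_chart twChart (ax_mem_twSource w) (ax_mem_twSource w') hxy
  · exact sep_ax_inf w
  · exact sep_symm (sep_zs_inf v')
  · exact sep_symm (sep_ax_inf w')
  · exact absurd rfl hxy

/-- `Bl₀(ℂ²) ∪ {∞}` is second countable (finite atlas). [folklore] -/
instance instSecondCountable : SecondCountableTopology BlowupPt := by
  refine ChartedSpace.secondCountable_of_countable_cover E4 (s := {zs 0, ax 0, inf}) ?_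
    (Set.toFinite _).countable
  apply Set.eq_univ_of_forall
  intro x
  simp only [mem_insert_iff, mem_singleton_iff, iUnion_iUnion_eq_or_left, iUnion_iUnion_eq_left,
    mem_union]
  rcases x with v | w | _
  · exact Or.inl ⟨v, rfl⟩
  · exact Or.inr (Or.inl (ax_mem_twSource w))
  · exact Or.inr (Or.inr inf_mem_infSource)

/-- Closed chart boxes covering `M`. [folklore] -/
def boxZs : Set E4 := {u | ‖(cx u).1‖ ≤ 2 ∧ ‖(cx u).2‖ ≤ 1}
/-- The closed chart box `{|t| ≤ 1, |w| ≤ 2}`. [folklore] -/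
def boxTw : Set E4 := {u | ‖(cx u).1‖ ≤ 1 ∧ ‖(cx u).2‖ ≤ 2}

/-- Closed chart boxes are compact. [folklore] -/
theorem isCompact_box (a b : ℝ) : IsCompact {u : E4 | ‖(cx u).1‖ ≤ a ∧ ‖(cx u).2‖ ≤ b} := by
  apply Metric.isCompact_of_isClosed_isBounded
  · exact (isClosed_le (continuous_norm.comp continuous_cx_fst) continuous_const).inter
      (isClosed_le (continuous_norm.comp continuous_cx_snd) continuous_const)
  · rw [isBounded_iff_forall_norm_le]
    refine ⟨|a| + |b|, fun u hu => ?_⟩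
    have := norm_rl_le (cx u) hu.1 hu.2
    rwa [rl_cx] at this

/-- The image of the box `{|z| ≤ 2, |s| ≤ 1}` is compact. [folklore] -/
theorem isCompact_image_boxZs : IsCompact (zsChart.symm '' boxZs) :=
  (isCompact_box 2 1).image_of_continuousOn (zsChart.continuousOn_symm.mono (subset_univ _))

/-- The image of the box `{|t| ≤ 1, |w| ≤ 2}` is compact. [folklore] -/
theorem isCompact_image_boxTw : IsCompact (twChart.symm '' boxTw) :=
  (isCompact_box 1 2).image_of_continuousOn (twChart.continuousOn_symm.mono (subset_univ _))

/-- The image of the closed ball of radius `1/2` under the inverse chart at infinity is compact. [folklore] -/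
theorem isCompact_image_closedBall : IsCompact (infChart.symm '' Metric.closedBall 0 2⁻¹) :=
  (isCompact_closedBall _ _).image_of_continuousOn
    (infChart.continuousOn_symm.mono (Metric.closedBall_subset_ball (by norm_num)))

/-- Points with `‖π x‖ ≥ 2` lie in the compact piece at infinity. [folklore] -/
theorem mem_image_closedBall_of_two_le {x : BlowupPt} (hx : 2 ≤ ‖rl (proj x)‖) :
    x ∈ infChart.symm '' Metric.closedBall 0 2⁻¹ := by
  have hne : x ≠ inf := by rintro rfl; norm_num [proj_inf] at hx
  have hsrc : x ∈ infSource := (mem_infSource_of_ne hne).2 (lt_of_lt_of_le one_lt_two hx)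
  refine ⟨infChart x, ?_, infChart.left_inv hsrc⟩
  rw [Metric.mem_closedBall, dist_zero_right, infChart_apply, infFun, norm_inversion]
  exact inv_anti₀ (by norm_num) hx

/-- `Bl₀(ℂ²) ∪ {∞}` is compact: it is covered by three compact chart pieces. [folklore] -/
instance instCompactSpace : CompactSpace BlowupPt := by
  refine ⟨?_⟩
  have hcov : (univ : Set BlowupPt) ⊆ (zsChart.symm '' boxZs ∪ twChart.symm '' boxTw) ∪ infChart.symm '' Metric.closedBall 0 2⁻¹ := by
    rintro x -
    rcases eq_or_ne x inf with rfl | hne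
    · exact Or.inr ⟨0, by simp, by simp [infInv]⟩
    by_cases hfar : 2 ≤ ‖rl (proj x)‖
    · exact Or.inr (mem_image_closedBall_of_two_le hfar)
    have hlt : ‖rl (proj x)‖ < 2 := not_le.1 hfar
    left
    rcases x with ⟨z, s⟩ | w | _
    · have hz : ‖z‖ < 2 := lt_of_le_of_lt (norm_fst_le_norm_rl (z, z * s)) hlt
      by_cases hs : ‖s‖ ≤ 1
      · left
        exact ⟨rl (z, s), ⟨by simpa using hz.le, by simpa using hs⟩, by simp⟩
      · right
        have hs0 : s ≠ 0 := by rintro rfl; simp at hs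
        refine ⟨twChart (zs (z, s)), ⟨?_, ?_⟩, twChart.left_inv ((zs_mem_twSource _).2 hs0)⟩
        · simp only [twChart_apply, twFun_zs, cx_rl, norm_inv]
          exact inv_le_one_of_one_le₀ (not_le.1 hs).le
        · simp only [twChart_apply, twFun_zs, cx_rl]
          exact (lt_of_le_of_lt (norm_snd_le_norm_rl (z, z * s)) hlt).le
    · right
      refine ⟨twChart (ax w), ⟨by simp, ?_⟩, twChart.left_inv (ax_mem_twSource w)⟩
      simp only [twChart_apply, twFun_ax, cx_rl]
      have := norm_snd_le_norm_rl ((0 : ℂ), w)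
      exact (this.trans (by simpa using hlt.le))
    · exact absurd rfl hne
  exact (((isCompact_image_boxZs.union isCompact_image_boxTw).union isCompact_image_closedBall).of_isClosed_subset
    isClosed_univ hcov)

end BlowupPt


/-! ### The punctured manifold `M ∖ ∞ = Bl₀(ℂ²)` and its charts -/

namespace BlowupPt

open TopologicalSpace

/-- `Bl₀(ℂ²) = M ∖ {∞}` as an open submanifold. [folklore] -/
abbrev blowup : Opens BlowupPt := punctured inf

/-- Points of `Bl₀(ℂ²)` are not `∞`. [folklore] -/
theorem val_ne_inf (x : blowup) : x.1 ≠ inf := mem_punctured.1 x.2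

/-- The extended chart of the open submanifold at `x`, as a function. [folklore] -/
theorem extChartAt_blowup_apply (x y : blowup) : extChartAt (𝓡 4) x y = chartAt E4 x.1 y.1 := rfl

/-- The inverse extended chart of the open submanifold is the inverse of the restricted chart. [folklore] -/
theorem extChartAt_blowup_symm_apply (x : blowup) (q : E4) :
    (extChartAt (𝓡 4) x).symm q = (chartAt E4 x).symm q := by
  rw [extChartAt_coe_symm, modelWithCornersSelf_coe_symm, Function.comp_apply, id]

/-- Near the image of a point of the chart source, the inverse of the restricted chart is the
inverse of the chart. [folklore] -/
theorem eventually_extChartAt_blowup_symm (x y : blowup) (hy : y.1 ∈ (chartAt E4 x.1).source) :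
    ∀ᶠ q in 𝓝 (chartAt E4 x.1 y.1), ((extChartAt (𝓡 4) x).symm q).1 = (chartAt E4 x.1).symm q := by
  have hopen : IsOpen ((chartAt E4 x.1).subtypeRestr ⟨x⟩).target := OpenPartialHomeomorph.open_target _
  have hmem : chartAt E4 x.1 y.1 ∈ ((chartAt E4 x.1).subtypeRestr ⟨x⟩).target :=
    (chartAt E4 x.1).map_subtype_source ⟨x⟩ hy
  filter_upwards [hopen.mem_nhds hmem] with q hq
  rw [extChartAt_blowup_symm_apply]
  exact ((chartAt E4 x.1).subtypeRestr_symm_eqOn ⟨x⟩ hq).symm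

/-- Source of the extended chart of the open submanifold. [folklore] -/
theorem extChartAt_blowup_source (x : blowup) : (extChartAt (𝓡 4) x).source = Subtype.val ⁻¹' (chartAt E4 x.1).source := by
  rw [extChartAt_source, Opens.chartAt_eq, OpenPartialHomeomorph.subtypeRestr_source]

/-- Source of the chart of the open submanifold. [folklore] -/
theorem chartAt_blowup_source (x : blowup) : (chartAt E4 x).source = Subtype.val ⁻¹' (chartAt E4 x.1).source := by
  rw [Opens.chartAt_eq, OpenPartialHomeomorph.subtypeRestr_source]


/-- The extended chart at `∞` is `ι ∘ π`, as a total function. [folklore] -/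
theorem extChartAt_inf_apply (x : BlowupPt) : extChartAt (𝓡 4) inf x = inversion (rl (proj x)) := rfl

/-- `e ∞ = 0` for the chart `e` at infinity. [folklore] -/
@[simp] theorem extChartAt_inf_inf : extChartAt (𝓡 4) inf inf = 0 := by
  rw [extChartAt_inf_apply, proj_inf, rl_zero, inversion_zero]

/-- The target of the chart at infinity is the unit ball. [folklore] -/
theorem extChartAt_inf_target : (extChartAt (𝓡 4) inf).target = Metric.ball 0 1 := by
  rw [extChartAt_target, chartAt_inf, infChart_target, modelWithCornersSelf_coe_symm, preimage_id,
    modelWithCornersSelf_coe, range_id, inter_univ]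

/-- The source of the chart at infinity. [folklore] -/
theorem chartAt_inf_source : (chartAt E4 inf).source = infSource := rfl

/-! ### Holomorphy of the charts `(z, s)`, `(t, w)`: derivatives commute with `mulI4` -/

/-- Transport of a complex derivative on `ℂ²` to `ℝ⁴`: the real derivative commutes with `mulI4`.
[folklore] -/
theorem exists_hasFDerivAt_comm_mulI4 {h : ℂ × ℂ → ℂ × ℂ} {p : E4} (hh : DifferentiableAt ℂ h (cx p)) :
    ∃ D : E4 →L[ℝ] E4, (∀ w, D (mulI4 w) = mulI4 (D w)) ∧ HasFDerivAt (fun q => rl (h (cx q))) D p := by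
  set L := fderiv ℂ h (cx p)
  have hL : HasFDerivAt h (L.restrictScalars ℝ) (cx p) := hh.hasFDerivAt.restrictScalars ℝ
  refine ⟨(cxEquiv.symm : ℂ × ℂ →L[ℝ] E4).comp ((L.restrictScalars ℝ).comp (cxEquiv : E4 →L[ℝ] ℂ × ℂ)),
    fun w => ?_, ?_⟩
  · simp only [ContinuousLinearMap.comp_apply, ContinuousLinearEquiv.coe_coe, cxEquiv_apply,
      cxEquiv_symm_apply]
    exact mulI4_comm_of_restrictScalars L w
  · exact cxEquiv.symm.hasFDerivAt.comp p (hL.comp p cxEquiv.hasFDerivAt)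

/-- The complex maps behind the charts. [folklore] -/
theorem differentiableAt_projZsC (p : ℂ × ℂ) : DifferentiableAt ℂ (fun p : ℂ × ℂ => (p.1, p.1 * p.2)) p :=
  differentiableAt_fst.prodMk (differentiableAt_fst.mul differentiableAt_snd)

/-- `(t, w) ↦ (t w, w)` is holomorphic. [folklore] -/
theorem differentiableAt_projTwC (p : ℂ × ℂ) : DifferentiableAt ℂ (fun p : ℂ × ℂ => (p.1 * p.2, p.2)) p :=
  (differentiableAt_fst.mul differentiableAt_snd).prodMk differentiableAt_snd

/-- `(t, w) ↦ (t w, t⁻¹)` is holomorphic off `{t = 0}`. [folklore] -/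
theorem differentiableAt_transTwZsC {p : ℂ × ℂ} (hp : p.1 ≠ 0) :
    DifferentiableAt ℂ (fun p : ℂ × ℂ => (p.1 * p.2, p.1⁻¹)) p :=
  (differentiableAt_fst.mul differentiableAt_snd).prodMk (differentiableAt_fst.inv hp)

/-- **The blow-down map is holomorphic in the charts**: for `x ≠ ∞` there are a smooth `P` and a
complex-linear `A` with `π ∘ (chart at x)⁻¹ = P` (in real coordinates) and `DP = A` at the
chart image of `x`. [folklore] -/
theorem chart_proj_data (x : BlowupPt) (hx : x ≠ inf) :
    ∃ (P : E4 → E4) (A : E4 →L[ℝ] E4), (∀ q, rl (proj ((chartAt E4 x).symm q)) = P q) ∧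
      (∀ w, A (mulI4 w) = mulI4 (A w)) ∧ HasFDerivAt P A (chartAt E4 x x) := by
  rcases x with v | w | _
  · obtain ⟨D, hD, hP⟩ := exists_hasFDerivAt_comm_mulI4 (p := chartAt E4 (zs v) (zs v))
      (differentiableAt_projZsC _)
    exact ⟨_, D, fun q => by simp, hD, hP⟩
  · obtain ⟨D, hD, hP⟩ := exists_hasFDerivAt_comm_mulI4 (p := chartAt E4 (ax w) (ax w))
      (differentiableAt_projTwC _)
    exact ⟨_, D, fun q => by simp [proj_twInv], hD, hP⟩
  · exact absurd rfl hx

/-- **The transition maps between the charts `(z, s)` and `(t, w)` are holomorphic**: their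
derivative commutes with `mulI4`. [folklore] -/
theorem chart_transition_data (x₀ x : BlowupPt) (h₀ : x₀ ≠ inf) (h : x ≠ inf)
    (hx : x ∈ (chartAt E4 x₀).source) :
    ∃ D : E4 →L[ℝ] E4, (∀ w, D (mulI4 w) = mulI4 (D w)) ∧
      HasFDerivAt (fun q => chartAt E4 x ((chartAt E4 x₀).symm q)) D (chartAt E4 x₀ x) := by
  rcases x₀ with v₀ | w₀ | _
  · rcases x with v | w | _
    · refine ⟨ContinuousLinearMap.id ℝ E4, fun w => rfl, ?_⟩
      have : (fun q : E4 => chartAt E4 (zs v) ((chartAt E4 (zs v₀)).symm q)) = id := by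
        funext q; simp
      rw [this]; exact hasFDerivAt_id _
    · obtain ⟨v, hv⟩ := hx; cases hv
    · exact absurd rfl h
  · rcases x with ⟨z, s⟩ | w | _
    · have hs : s ≠ 0 := hx
      have hq₀ : (cx (chartAt E4 (ax w₀) (zs (z, s)))).1 ≠ 0 := by
        simpa using hs
      obtain ⟨D, hD, hF⟩ := exists_hasFDerivAt_comm_mulI4 (p := chartAt E4 (ax w₀) (zs (z, s)))
        (differentiableAt_transTwZsC hq₀)
      refine ⟨D, hD, hF.congr_of_eventuallyEq ?_⟩
      filter_upwards [isOpen_cx_fst_ne.mem_nhds hq₀] with q hq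
      have hq' : (cx q).1 ≠ 0 := hq
      simp [twInv, hq']
    · refine ⟨ContinuousLinearMap.id ℝ E4, fun w => rfl, ?_⟩
      have : (fun q : E4 => chartAt E4 (ax w) ((chartAt E4 (ax w₀)).symm q)) = id := by
        funext q
        exact twEquiv.right_inv (mem_univ q)
      rw [this]; exact hasFDerivAt_id _
    · exact absurd rfl h
  · exact absurd rfl h₀

/-! ### The almost complex structure `J ≡ i` on `Bl₀(ℂ²)` and the hypotheses of the fact -/

/-- The (integrable) complex structure of the blow-up, in the tangent trivialisations of the
holomorphic charts `chartAt x ∈ {(z,s), (t,w)}`: constantly `mulI4`. [folklore] -/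
def blowupJ (x : blowup) : TangentSpace (𝓡 4) x →L[ℝ] TangentSpace (𝓡 4) x := mulI4

/-- `J² = -1`. [folklore] -/
theorem blowupJ_sq (x : blowup) (v : TangentSpace (𝓡 4) x) : blowupJ x (blowupJ x v) = -v := mulI4_mulI4 v

/-- One coordinate change of `T(Bl₀ ℂ²)` is complex linear. [folklore] -/
theorem tangentCoordChange_mulI4 (x₀ x : blowup) (hx : x.1 ∈ (chartAt E4 x₀.1).source) (w : E4) :
    tangentCoordChange (𝓡 4) x₀ x x (mulI4 w) = mulI4 (tangentCoordChange (𝓡 4) x₀ x x w) := by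
  rw [tangentCoordChange_def, modelWithCornersSelf_coe, range_id, fderivWithin_univ]
  have hT : (↑(extChartAt (𝓡 4) x) ∘ ↑(extChartAt (𝓡 4) x₀).symm) =ᶠ[𝓝 (extChartAt (𝓡 4) x₀ x)]
      fun q => chartAt E4 x.1 ((chartAt E4 x₀.1).symm q) := by
    filter_upwards [eventually_extChartAt_blowup_symm x₀ x hx] with q hq
    rw [Function.comp_apply, extChartAt_blowup_apply, hq]
  rw [hT.fderiv_eq]
  obtain ⟨D, hD, hTD⟩ := chart_transition_data x₀.1 x.1 (val_ne_inf x₀) (val_ne_inf x) hx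
  rw [show extChartAt (𝓡 4) x₀ x = chartAt E4 x₀.1 x.1 from rfl, hTD.fderiv]
  exact hD w

/-- **`J` is smooth** (in tangent coordinates it is locally the constant `mulI4`).
[folklore] -/
theorem blowupJ_smooth (x₀ : blowup) :
    ContMDiffAt (𝓡 4) 𝓘(ℝ, E4 →L[ℝ] E4) ∞
      (inTangentCoordinates (𝓡 4) (𝓡 4) (id : blowup → blowup) id (fun x => blowupJ x) x₀) x₀ := by
  have hev : inTangentCoordinates (𝓡 4) (𝓡 4) (id : blowup → blowup) id (fun x => blowupJ x) x₀ =ᶠ[𝓝 x₀]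
      fun _ => mulI4 := by
    have hopen : IsOpen {x : blowup | x.1 ∈ (chartAt E4 x₀.1).source} :=
      (chartAt E4 x₀.1).open_source.preimage continuous_subtype_val
    filter_upwards [hopen.mem_nhds (mem_chart_source E4 x₀.1)] with x hx
    have hx' : x ∈ (chartAt E4 x₀).source := by rwa [chartAt_blowup_source]
    rw [inTangentCoordinates_eq (I := 𝓡 4) (I' := 𝓡 4) id id (fun x => blowupJ x) hx' hx']
    refine ContinuousLinearMap.ext fun w => ?_
    change tangentCoordChange (𝓡 4) x x₀ x (mulI4 (tangentCoordChange (𝓡 4) x₀ x x w)) = mulI4 w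
    have hsrc₀ : x ∈ (extChartAt (𝓡 4) x₀).source := by rwa [extChartAt_source]
    have hsrc : x ∈ (extChartAt (𝓡 4) x).source := mem_extChartAt_source x
    rw [← tangentCoordChange_mulI4 x₀ x hx, tangentCoordChange_comp ⟨⟨hsrc₀, hsrc⟩, hsrc₀⟩,
      tangentCoordChange_self hsrc₀]
  exact contMDiffAt_const.congr_of_eventuallyEq hev

/-- `D(ι ∘ ι) = id`: `Dι(ι y) ∘ Dι(y) = id` for `y ≠ 0`. [folklore] -/
theorem fderiv_inversion_inversion_apply {y : E4} (hy : y ≠ 0) (w : E4) :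
    fderiv ℝ inversion (inversion y) (fderiv ℝ inversion y w) = w := by
  have h1 : HasFDerivAt inversion (fderiv ℝ inversion y) y := (differentiableAt_inversion hy).hasFDerivAt
  have h2 : HasFDerivAt inversion (fderiv ℝ inversion (inversion y)) (inversion y) :=
    (differentiableAt_inversion (inversion_ne_zero hy)).hasFDerivAt
  have h3 := h2.comp y h1
  have h4 : (inversion ∘ inversion : E4 → E4) = id := funext inversion_inversion
  rw [h4] at h3
  have h5 := h3.unique (hasFDerivAt_id y)
  exact congrArg (fun L : E4 →L[ℝ] E4 => L w) h5

/-- **The derivative of the chart at infinity on `Bl₀(ℂ²)`**: `De_x = Dι(π x) ∘ A` with `A` complex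
linear. [folklore] -/
theorem hasMFDerivAt_extChartAt_inf (x : blowup) (hsrc : x.1 ∈ infSource) :
    ∃ A : E4 →L[ℝ] E4, (∀ w, A (mulI4 w) = mulI4 (A w)) ∧
      HasMFDerivAt (𝓡 4) 𝓘(ℝ, E4) (fun z : blowup => extChartAt (𝓡 4) inf z.1) x
        ((fderiv ℝ inversion (rl (proj x.1))).comp A) := by
  obtain ⟨P, A, hP, hA, hPA⟩ := chart_proj_data x.1 (val_ne_inf x)
  have hy : rl (proj x.1) ≠ 0 := norm_pos_iff.1 (norm_rl_proj_pos_of_mem_infSource hsrc (val_ne_inf x))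
  have hPq : P (chartAt E4 x.1 x.1) = rl (proj x.1) := by
    rw [← hP, (chartAt E4 x.1).left_inv (mem_chart_source E4 x.1)]
  refine ⟨A, hA, ?_, ?_⟩
  · have hc : ContinuousAt infFun x.1 :=
      infChart.continuousOn.continuousAt (isOpen_infSource.mem_nhds hsrc)
    exact hc.comp continuous_subtype_val.continuousAt
  · simp only [writtenInExtChartAt, extChartAt_model_space_eq_id, PartialEquiv.refl_coe,
      Function.id_comp, modelWithCornersSelf_coe, range_id]
    apply HasFDerivAt.hasFDerivWithinAt
    have hev : ((fun z : blowup => extChartAt (𝓡 4) inf z.1) ∘ ↑(extChartAt (𝓡 4) x).symm)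
        =ᶠ[𝓝 (extChartAt (𝓡 4) x x)] fun q => inversion (P q) := by
      filter_upwards [eventually_extChartAt_blowup_symm x x (mem_chart_source E4 x.1)] with q hq
      rw [Function.comp_apply, extChartAt_inf_apply, hq, hP]
    refine HasFDerivAt.congr_of_eventuallyEq ?_ hev
    rw [show extChartAt (𝓡 4) x x = chartAt E4 x.1 x.1 from rfl]
    have h1 : HasFDerivAt inversion (fderiv ℝ inversion (rl (proj x.1))) (P (chartAt E4 x.1 x.1)) := by
      rw [hPq]; exact (differentiableAt_inversion hy).hasFDerivAt
    exact h1.comp _ hPA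

/-- **`J` is standard on the punctured chart ball at `∞`** (indeed on the whole chart source):
`⟪Dψ(J v), c⟫ = ω₀(Dψ v, c)` with `ψ = ι ∘ (e − e ∞)`. [folklore] -/
theorem blowupJ_standard (x : blowup) (hsrc : x.1 ∈ (chartAt E4 inf).source) (v : TangentSpace (𝓡 4) x) (c : E4) :
    inner ℝ (fderiv ℝ inversion (extChartAt (𝓡 4) inf x.1 - extChartAt (𝓡 4) inf inf)
      (mfderiv (𝓡 4) 𝓘(ℝ, E4) (fun z : blowup => extChartAt (𝓡 4) inf z.1) x (blowupJ x v))) c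
    = stdSymplecticForm (fderiv ℝ inversion (extChartAt (𝓡 4) inf x.1 - extChartAt (𝓡 4) inf inf)
      (mfderiv (𝓡 4) 𝓘(ℝ, E4) (fun z : blowup => extChartAt (𝓡 4) inf z.1) x v)) c := by
  rw [chartAt_inf_source] at hsrc
  obtain ⟨A, hA, hmf⟩ := hasMFDerivAt_extChartAt_inf x hsrc
  have hy : rl (proj x.1) ≠ 0 := norm_pos_iff.1 (norm_rl_proj_pos_of_mem_infSource hsrc (val_ne_inf x))
  rw [hmf.mfderiv, extChartAt_inf_inf, sub_zero, extChartAt_inf_apply]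
  change inner ℝ (fderiv ℝ inversion (inversion (rl (proj x.1)))
      (fderiv ℝ inversion (rl (proj x.1)) (A (mulI4 v)))) c =
    stdSymplecticForm (fderiv ℝ inversion (inversion (rl (proj x.1)))
      (fderiv ℝ inversion (rl (proj x.1)) (A v))) c
  rw [fderiv_inversion_inversion_apply hy, fderiv_inversion_inversion_apply hy, hA,
    inner_mulI4_eq_stdSymplecticForm]

/-! ### `π` is continuous on `Bl₀(ℂ²)`; `pencilCoord = π` -/

/-- The blow-down map `π` is continuous at every point of `Bl₀(ℂ²)`. [folklore] -/
theorem continuousAt_rl_proj {x : BlowupPt} (hx : x ≠ inf) : ContinuousAt (fun x => rl (proj x)) x := by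
  obtain ⟨P, A, hP, -, hPA⟩ := chart_proj_data x hx
  have hev : (fun x' => rl (proj x')) =ᶠ[𝓝 x] fun x' => P (chartAt E4 x x') := by
    filter_upwards [(chartAt E4 x).open_source.mem_nhds (mem_chart_source E4 x)] with x' hx'
    rw [← hP, (chartAt E4 x).left_inv hx']
  refine (ContinuousAt.congr ?_ hev.symm)
  exact hPA.continuousAt.comp ((chartAt E4 x).continuousAt (mem_chart_source E4 x))

/-- `π` (real coordinates) is continuous on the open submanifold `Bl₀(ℂ²)`. [folklore] -/
theorem continuous_rl_proj_blowup : Continuous fun y : blowup => rl (proj y.1) :=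
  continuous_iff_continuousAt.2 fun y =>
    (continuousAt_rl_proj (val_ne_inf y)).comp continuous_subtype_val.continuousAt

/-- `π` is continuous on the open submanifold `Bl₀(ℂ²)`. [folklore] -/
theorem continuous_proj_blowup : Continuous fun y : blowup => proj y.1 := by
  have : (fun y : blowup => proj y.1) = fun y => cx (rl (proj y.1)) := by funext y; rw [cx_rl]
  rw [this]
  exact continuous_cx.comp continuous_rl_proj_blowup

/-- **The flat coordinates of the end are the blow-down map**: `pencilCoord ∞ x = π x` (exactly,
for every `x ≠ ∞`, thanks to the total definition `e = ι ∘ π` of the chart at infinity).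
[folklore] -/
theorem pencilCoord_eq (x : blowup) : pencilCoord inf x = proj x.1 := by
  change cx (inversion (extChartAt (𝓡 4) inf x.1 - extChartAt (𝓡 4) inf inf)) = proj x.1
  rw [extChartAt_inf_inf, sub_zero, extChartAt_inf_apply, inversion_inversion, cx_rl]

/-! ### The pencil member `u₀`: the proper transform of the `z`-axis `{w = 0}` -/

/-- The proper transform of the line `{w = 0}`: `ξ ↦ ((ξ, 0), [1 : 0])`, i.e. `zs (ξ, 0)`; it passes
through the point `[1 : 0]` of the exceptional sphere. [folklore] -/
def u₀ (ξ : ℂ) : blowup := ⟨zs (ξ, 0), by simp⟩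

/-- `u₀ ξ` is the point `zs (ξ, 0)`. [folklore] -/
@[simp] theorem u₀_val (ξ : ℂ) : (u₀ ξ).1 = zs (ξ, 0) := rfl

/-- `u₀` is continuous. [folklore] -/
theorem continuous_u₀ : Continuous u₀ :=
  (continuous_zs.comp (continuous_id.prodMk continuous_const)).subtype_mk _

/-- The derivative of `u₀` in the chart `(z, s)`: `ζ ↦ (ζ, 0)`. [folklore] -/
def du₀ : ℂ →L[ℝ] E4 := (cxEquiv.symm : ℂ × ℂ →L[ℝ] E4).comp ((ContinuousLinearMap.id ℝ ℂ).prod 0)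

/-- `du₀ ζ = rl (ζ, 0)`. [folklore] -/
@[simp] theorem du₀_apply (ζ : ℂ) : du₀ ζ = rl (ζ, 0) := rfl

/-- `ζ ↦ rl (ζ, 0)` has derivative `du₀`. [folklore] -/
theorem hasFDerivAt_rl_inl (ξ : ℂ) : HasFDerivAt (fun ζ : ℂ => rl (ζ, 0)) du₀ ξ :=
  cxEquiv.symm.hasFDerivAt.comp ξ ((hasFDerivAt_id ξ).prodMk (hasFDerivAt_const (0 : ℂ) ξ))

/-- `u₀` read in the charts is `ζ ↦ rl (ζ, 0)`. [folklore] -/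
theorem writtenInExtChartAt_u₀ (ξ : ℂ) :
    writtenInExtChartAt 𝓘(ℝ, ℂ) (𝓡 4) ξ u₀ = fun ζ : ℂ => rl (ζ, 0) := by
  funext ζ
  simp only [writtenInExtChartAt, Function.comp_apply, extChartAt_model_space_eq_id,
    PartialEquiv.refl_symm, PartialEquiv.refl_coe, id_eq]
  rfl

/-- The manifold derivative of `u₀` is `du₀`. [folklore] -/
theorem hasMFDerivAt_u₀ (ξ : ℂ) : HasMFDerivAt 𝓘(ℝ, ℂ) (𝓡 4) u₀ ξ du₀ := by
  refine ⟨continuous_u₀.continuousAt, ?_⟩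
  rw [writtenInExtChartAt_u₀]
  simp only [modelWithCornersSelf_coe, range_id, extChartAt_self_apply]
  exact (hasFDerivAt_rl_inl ξ).hasFDerivWithinAt

/-- `mfderiv u₀ ξ = du₀`. [folklore] -/
theorem mfderiv_u₀ (ξ : ℂ) : mfderiv 𝓘(ℝ, ℂ) (𝓡 4) u₀ ξ = du₀ := (hasMFDerivAt_u₀ ξ).mfderiv

/-- `u₀` is `C^∞`. [folklore] -/
theorem contMDiff_u₀ : ContMDiff 𝓘(ℝ, ℂ) (𝓡 4) ∞ u₀ := by
  rw [← ContMDiff.subtypeVal_comp_iff]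
  intro ξ
  rw [contMDiffAt_iff_target]
  refine ⟨(continuous_zs.comp (continuous_id.prodMk continuous_const)).continuousAt, ?_⟩
  have : (↑(extChartAt (𝓡 4) ((Subtype.val ∘ u₀) ξ)) ∘ Subtype.val ∘ u₀) = fun ζ : ℂ => rl (ζ, 0) := by
    funext ζ; simp
  rw [this, contMDiffAt_iff_contDiffAt]
  exact (contDiff_rl.comp (contDiff_id.prodMk contDiff_const)).contDiffAt

/-- `du₀` is injective (`u₀` is immersed). [folklore] -/
theorem du₀_injective : Function.Injective du₀ := by
  intro a b h
  simp only [du₀_apply] at h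
  have := congrArg Prod.fst (rl_injective h)
  exact this

/-- **`u₀` is a pencil member of intercept `0`.** [folklore] -/
theorem isPencilPlane_u₀ : IsPencilPlane blowupJ u₀ 0 := by
  refine ⟨⟨contMDiff_u₀, ⟨0, 1, by simp [u₀, Subtype.ext_iff]⟩, ?_⟩, ?_, ?_, ?_, ?_, ?_⟩
  · -- `blowupJ`-holomorphic
    intro ξ ζ
    rw [mfderiv_u₀]
    change du₀ (Complex.I * ζ) = mulI4 (du₀ ζ)
    rw [du₀_apply, du₀_apply, mulI4_apply, cx_rl, Prod.smul_mk, smul_eq_mul, smul_zero]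
  · -- injective
    intro a b h
    have := congrArg (fun y : blowup => y.1) h
    simp only [u₀_val, zs.injEq, Prod.mk.injEq, and_true] at this
    exact this
  · -- immersed
    intro ξ
    rw [mfderiv_u₀]
    exact du₀_injective
  · -- proper
    intro K hK
    have hKc : IsCompact (Subtype.val '' K) := hK.image continuous_subtype_val
    apply Metric.isCompact_of_isClosed_isBounded
    · have : u₀ ⁻¹' K = (fun ξ => zs (ξ, 0)) ⁻¹' (Subtype.val '' K) := by
        ext ξ
        simp only [mem_preimage, mem_image, Subtype.exists, exists_and_right, exists_eq_right]
        exact ⟨fun h => ⟨(u₀ ξ).2, h⟩, fun ⟨_, h⟩ => h⟩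
      rw [this]
      exact hKc.isClosed.preimage (continuous_zs.comp (continuous_id.prodMk continuous_const))
    · obtain ⟨C, hC⟩ := (hK.image continuous_rl_proj_blowup).isBounded.subset_closedBall 0
      rw [isBounded_iff_forall_norm_le]
      refine ⟨C, fun ξ hξ => ?_⟩
      have h1 : rl (proj (u₀ ξ).1) ∈ Metric.closedBall (0 : E4) C := hC ⟨u₀ ξ, hξ, rfl⟩
      rw [Metric.mem_closedBall, dist_zero_right] at h1
      exact (norm_fst_le_norm_rl ((ξ : ℂ), ξ * 0)).trans h1
  · -- `z(u₀ ξ) - ξ → 0`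
    simp [pencilCoord_eq]
  · -- `w(u₀ ξ) → 0`
    simp [pencilCoord_eq]

/-! ### Members of non-zero intercept are the lifted lines (Liouville) -/

/-- A continuous function `ℂ → ℂ` with a limit at infinity is bounded. [folklore] -/
theorem isBounded_range_of_tendsto_cocompact {F : ℂ → ℂ} (hc : Continuous F) {c : ℂ}
    (h : Tendsto F (cocompact ℂ) (𝓝 c)) : Bornology.IsBounded (Set.range F) := by
  have h1 : ∀ᶠ ξ in cocompact ℂ, F ξ ∈ Metric.ball c 1 := h (Metric.ball_mem_nhds c one_pos)
  rw [Filter.Eventually, Filter.mem_cocompact] at h1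
  obtain ⟨K, hK, hKsub⟩ := h1
  have hb : Bornology.IsBounded (F '' K ∪ Metric.ball c 1) :=
    (hK.image hc).isBounded.union Metric.isBounded_ball
  refine hb.subset ?_
  rintro _ ⟨ξ, rfl⟩
  by_cases hξ : ξ ∈ K
  · exact Or.inl ⟨ξ, hξ, rfl⟩
  · exact Or.inr (hKsub hξ)

/-- An entire function tending to `c` at infinity is the constant `c`. [folklore] -/
theorem eq_const_of_differentiable_of_tendsto {F : ℂ → ℂ} (hF : Differentiable ℂ F) {c : ℂ}
    (h : Tendsto F (cocompact ℂ) (𝓝 c)) (ξ : ℂ) : F ξ = c := by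
  have hb := isBounded_range_of_tendsto_cocompact hF.continuous h
  have hconst : ∀ ζ, F ζ = F ξ := fun ζ => hF.apply_eq_apply_of_bounded hb ζ ξ
  have h2 : Tendsto F (cocompact ℂ) (𝓝 (F ξ)) := by
    have : F = fun _ => F ξ := funext hconst
    rw [this]; exact tendsto_const_nhds
  exact (tendsto_nhds_unique h2 h).symm ▸ rfl

/-- **The blow-down of a `J`-curve is holomorphic**: for `u : ℂ → Bl₀(ℂ²)` smooth and
`J`-holomorphic, `π ∘ u : ℂ → ℂ²` is complex differentiable. [folklore] -/
theorem differentiable_proj_comp {u : ℂ → blowup} (hu : IsEntireJCurve (𝓡 4) blowupJ u) :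
    Differentiable ℂ fun ξ => proj (u ξ).1 := by
  obtain ⟨hsmooth, -, hhol⟩ := hu
  intro ξ
  set x := u ξ with hx
  have hmd : MDifferentiableAt 𝓘(ℝ, ℂ) (𝓡 4) u ξ := (hsmooth ξ).mdifferentiableAt (by simp)
  -- the written expression `g = chart ∘ u` has derivative `du(ξ)` at `ξ`
  have hg : HasFDerivAt (fun ζ => chartAt E4 x.1 (u ζ).1) (mfderiv 𝓘(ℝ, ℂ) (𝓡 4) u ξ) ξ := by
    have h2 := hmd.hasMFDerivAt.2
    simp only [writtenInExtChartAt, modelWithCornersSelf_coe, range_id,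
      hasFDerivWithinAt_univ, extChartAt_model_space_eq_id, PartialEquiv.refl_symm,
      PartialEquiv.refl_coe, Function.comp_id] at h2
    exact h2
  have key : ∀ ζ : ℂ, mfderiv 𝓘(ℝ, ℂ) (𝓡 4) u ξ (Complex.I * ζ : ℂ) =
      mulI4 (mfderiv 𝓘(ℝ, ℂ) (𝓡 4) u ξ (ζ : ℂ)) := fun ζ => hhol ξ ζ
  obtain ⟨P, A, hP, hA, hPA⟩ := chart_proj_data x.1 (val_ne_inf x)
  -- near `ξ`, `π ∘ u = cx ∘ P ∘ g`
  have hev : (fun ζ => proj (u ζ).1) =ᶠ[𝓝 ξ] fun ζ => cx (P (chartAt E4 x.1 (u ζ).1)) := by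
    have hc : ContinuousAt (fun ζ => (u ζ).1) ξ :=
      continuous_subtype_val.continuousAt.comp hmd.continuousAt
    have hmem : ∀ᶠ ζ in 𝓝 ξ, (u ζ).1 ∈ (chartAt E4 x.1).source :=
      hc.preimage_mem_nhds ((chartAt E4 x.1).open_source.mem_nhds (mem_chart_source E4 x.1))
    filter_upwards [hmem] with ζ hζ
    rw [← hP, (chartAt E4 x.1).left_inv hζ, cx_rl]
  refine DifferentiableAt.congr_of_eventuallyEq ?_ hev
  -- the real derivative of `cx ∘ P ∘ g` at `ξ` is complex linear
  set M : ℂ →L[ℝ] ℂ × ℂ := (cxEquiv : E4 →L[ℝ] ℂ × ℂ).comp (A.comp (mfderiv 𝓘(ℝ, ℂ) (𝓡 4) u ξ))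
    with hM
  have hder : HasFDerivAt (fun ζ => cx (P (chartAt E4 x.1 (u ζ).1))) M ξ :=
    cxEquiv.hasFDerivAt.comp ξ (hPA.comp ξ hg)
  have hMI : ∀ ζ : ℂ, M (Complex.I * ζ) = Complex.I • M ζ := fun ζ => by
    show cx (A (mfderiv 𝓘(ℝ, ℂ) (𝓡 4) u ξ (Complex.I * ζ : ℂ))) =
      Complex.I • cx (A (mfderiv 𝓘(ℝ, ℂ) (𝓡 4) u ξ (ζ : ℂ)))
    rw [key ζ, hA, cx_mulI4]
  obtain ⟨g, hg'⟩ := exists_restrictScalars_eq_of_map_mul_I M hMI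
  exact (differentiableAt_iff_restrictScalars ℝ hder.differentiableAt).2
    ⟨g, hg'.trans hder.fderiv.symm⟩

/-- **Members of intercept `b` blow down to the line `{w = b}`, identically parametrised**:
`π (u ξ) = (ξ, b)` (Liouville). [folklore] -/
theorem proj_member {u : ℂ → blowup} {b : ℂ} (hu : IsPencilPlane blowupJ u b) (ξ : ℂ) :
    proj (u ξ).1 = (ξ, b) := by
  obtain ⟨hent, -, -, -, h1, h2⟩ := hu
  have hf := differentiable_proj_comp hent
  simp only [pencilCoord_eq] at h1 h2
  have e1 := eq_const_of_differentiable_of_tendsto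
    ((differentiable_fst.comp hf).sub differentiable_id) h1 ξ
  have e2 := eq_const_of_differentiable_of_tendsto (differentiable_snd.comp hf) h2 ξ
  simp only [Pi.sub_apply, Function.comp_apply, id_eq, sub_eq_zero] at e1 e2
  exact Prod.ext e1 e2

/-- The point of `Bl₀(ℂ²)` over `(0, b)`, `b ≠ 0`, is `ax b`. [folklore] -/
theorem eq_ax_of_proj_eq {x : BlowupPt} (hx : x ≠ inf) {b : ℂ} (hb : b ≠ 0) (h : proj x = (0, b)) :
    x = ax b := by
  rcases x with ⟨z, s⟩ | w | _
  · simp only [proj_zs, Prod.mk.injEq] at h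
    obtain ⟨rfl, h2⟩ := h
    exact absurd (by simpa using h2.symm) hb
  · simp only [proj_ax, Prod.mk.injEq, true_and] at h
    rw [h]
  · exact absurd rfl hx

/-- A member of intercept `b ≠ 0` passes through `ax b = π⁻¹(0, b)` at `ξ = 0`. [folklore] -/
theorem member_zero {u : ℂ → blowup} {b : ℂ} (hu : IsPencilPlane blowupJ u b) (hb : b ≠ 0) :
    (u 0).1 = ax b :=
  eq_ax_of_proj_eq (val_ne_inf _) hb (by simpa using proj_member hu 0)

/-! ### The refutation -/

/-- The closed `1/2`-ball about `e ∞ = 0` lies in the target of the chart at infinity. [folklore] -/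
theorem closedBall_subset_target :
    Metric.closedBall (extChartAt (𝓡 4) inf inf) 2⁻¹ ⊆ (extChartAt (𝓡 4) inf).target := by
  rw [extChartAt_inf_inf, extChartAt_inf_target]
  exact Metric.closedBall_subset_ball (by norm_num)

end BlowupPt

end JPlanePencilCounterexample

-- names the `@[deprecated]` record `jPlanePencil_localFamily` of `JPlanePencilLocalFamily.lean` on purpose: this IS
-- its refutation (verdict clean-up 2026-08-17); REMOVE-WHEN the record is deleted from `JPlanePencilLocalFamily.lean`
set_option linter.deprecated false in
open JPlanePencilCounterexample JPlanePencilCounterexample.BlowupPt in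
/-- **`jPlanePencil_localFamily` is false.** On `M = Bl₀(ℂ²) ∪ {∞} ≅ ℂP²-bar` with `p = ∞`,
`J` the complex structure of the blow-up (standard on the whole chart at infinity) and `u₀` the
proper transform of the `z`-axis (a member of intercept `0`), every member of intercept `b ≠ 0` is
the lifted line `π⁻¹{w = b}` and passes through `π⁻¹(0, b) = ax b` at `ξ = 0`; these points tend
to `[0 : 1] = ax 0 ∈ E` as `b → 0`, not to `u₀ 0 = [1 : 0]`, so no family `Floc` through `u₀`
can be jointly continuous at `(b₀, ξ) = (0, 0)`. [cite: Wendl2018, §3.1, Prop. 2.53] -/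
theorem not_jPlanePencil_localFamily : ¬ jPlanePencil_localFamily := by
  intro H
  obtain ⟨δ, hδ, Floc, hF0, hmem, hsmooth, -, -⟩ := H BlowupPt inf blowupJ 2⁻¹ (by norm_num)
    closedBall_subset_target blowupJ_sq blowupJ_smooth (fun x hx v c => blowupJ_standard x hx.1 v c) u₀ 0
    isPencilPlane_u₀
  -- continuity of `b ↦ Floc b 0` at `b = 0`
  have hcont : ContinuousAt (fun q : ℂ × ℂ => Floc q.1 q.2) (0, 0) :=
    hsmooth.continuousOn.continuousAt
      (((Metric.isOpen_ball).prod isOpen_univ).mem_nhds ⟨Metric.mem_ball_self hδ, mem_univ _⟩)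
  have hT : Tendsto (fun b : ℂ => (Floc b 0).1) (𝓝 0) (𝓝 (zs (0, 0))) := by
    have h1 : Tendsto (fun b : ℂ => ((b, (0 : ℂ)) : ℂ × ℂ)) (𝓝 0) (𝓝 (0, 0)) :=
      (continuous_id.prodMk continuous_const).continuousAt
    have h2 := (continuous_subtype_val.continuousAt.comp hcont).tendsto.comp h1
    have h3 : (Floc 0 0).1 = zs (0, 0) := by rw [hF0]; rfl
    simpa [Function.comp_def, h3] using h2
  have hT₁ : Tendsto (fun b : ℂ => (Floc b 0).1) (𝓝[≠] 0) (𝓝 (zs (0, 0))) :=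
    hT.mono_left nhdsWithin_le_nhds
  -- but for `b ≠ 0` small, `Floc b 0 = ax b → ax 0`
  have hev : (fun b : ℂ => (Floc b 0).1) =ᶠ[𝓝[≠] (0 : ℂ)] fun b => ax b := by
    have hball : ∀ᶠ b in 𝓝[≠] (0 : ℂ), b ∈ Metric.ball (0 : ℂ) δ :=
      nhdsWithin_le_nhds (Metric.ball_mem_nhds 0 hδ)
    filter_upwards [hball, self_mem_nhdsWithin] with b hb hb0
    exact member_zero (hmem b hb) hb0
  have hT₂ : Tendsto (fun b : ℂ => (Floc b 0).1) (𝓝[≠] 0) (𝓝 (ax 0)) :=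
    (continuous_ax.continuousAt.tendsto.mono_left nhdsWithin_le_nhds).congr' hev.symm
  have := tendsto_nhds_unique hT₁ hT₂
  cases this

end Literature.Geometry.Symplectic
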